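import Literature.MathematicalPhysics.QuantumFieldTheory.Dimock2011to13.Phi43PolymerRepresentation

/-!
# Dimock, *The renormalization group according to Balaban* III, §3.6 from (under2) on: the linear distance
modulo holes `d_M(X, mod Ω^c)` of part II on the torus, LEMMA 16 (the three-sorted tree-length bound) PROVED,
and (under2) ⇒ (under3) ⇒ (toot) PROVED — so that §3.6 is kernel-checked from (under2) ∧ (stingray) to Corollary 1

**Citation header (reproduction of PUBLISHED work; template of the Balaban lattice Yang–Mills cell).**
J. Dimock, *The renormalization group according to Balaban. III. Convergence*, Ann. Henri Poincaré **15** (2014)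
2133–2175 (= arXiv:1304.0705v1) [Dimock2013BalabanIII], §3.6 "the stability bound": eq. (under2) (TeX L2349–2358),
Lemma 16 (TeX L2362–2385; the 16th `\begin{lem}` under the global counter `\newtheorem{lem}{Lemma}` of the arXiv source,
unlabelled — Lemma 14 = (ugh2) L2173, Lemma 15 = (sushi) L2254, Lemma 17 = (swat) L2393), eq. (under3) (L2408–2417) and
the resummations up to eq. (toot) (L2419–2442); §3.1 for the index sets (TeX L1469–1471, L1508–1512).  J. Dimock, *The
renormalization group according to Balaban. II. Large fields*, J. Math. Phys. **54** (2013) 092301 (= arXiv:1212.5562v2)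
[Dimock2013BalabanII], §3.3 "polymers" (TeX L1676–1705): the polymers with holes 𝒟_k(mod Ω^c_k), the linear distance
d_M(X, mod Ω^c_k) and the summation bound (snow) (= App. E Lemma E.3 (sumsum), TeX L6914–6920).  TeX line numbers refer
to the arXiv sources held by the cell (`inputs/files/dimock/src/1304.0705/1304.0705.tex`, `…/1212.5562/*.tex`); every
quotation below was read there.  Dimock's papers are published and refereed and are the cell's TEMPLATE, not
manuscripts under audit; no quantity of the Bałaban series is touched.

**Why this module.**  The sibling `…Dimock2011to13.Phi43PolymerRepresentation` (this lineage; v2.2 p182971) made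
[Dimock2013BalabanIII] §3.6 kernel FROM (toot) ON: (toot) ⇒ Lemma 17 (swat) ⇒ [with (stingray)] Theorem 2 ⇒ Corollary 1
(`componentActivityBound_of_toot`, `stability_of_toot`), and recorded as NOT kernel *"(under2) → (under3) → (toot)
(needs D3 Lemma 13's [read: Lemma 16's] three-sorted «mod Θ» union bound — no tree notion)"* (cell GAPS.md C-tmpl13-4;
TEMPLATE.md v8.12 §15.2).  The missing notion is [Dimock2013BalabanII]'s `d_M(X, mod Ω^c)` — trees CONTAINED IN X but
required to meet only the cubes of X OUTSIDE the holes — on the cell's periodic carrier (unit pv22's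
`…Balaban1983to89.TreeLengthTorus`: graphs in the universal cover).  This module supplies it and closes the link.

**What is reproduced here (kernel-checked; Mathlib + the imported cell modules only).**
* Part 1 — GRAPHS WITH A TARGET FAMILY: `TCover S B T` (a connected polygonal graph in `π⁻¹(S)` meeting a lift of every
  cube of `B`; `TCover X X` = pv22's `TAdmissible X`), deck invariance and re-sheeting, the two JOIN lemmas (common cube:
  cost ≤ 1; common wall on the torus: cost ≤ 2) and the GLUING INDUCTION `exists_tCover_glue` / `coverLen_biUnion_add_two_le`
  — ports of unit pv22's `TreeLengthTorusGeometry.tAdmissible_translate / exists_translate_meets / tAdmissible_join_common /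
  tAdmissible_join_adj / exists_tAdmissible_glue / torusTreeLen_biUnion_add_two_le` ([Balaban1988RG2Cluster] (2.27)) from
  "graphs meeting all cubes of their own domain" to "graphs in a common ambient family meeting a target family"; the
  length `coverLen S B` (infimum), with `torusTreeLen X = coverLen X X` (`torusTreeLen_eq_coverLen`).
* Part 2 — THE NOTION: `TAdmissibleMod X Θ` / `torusTreeLenMod X Θ` = [Dimock2013BalabanII]'s d_M(X, mod Ω^c_k) with `Θ`
  the family of cubes of the holes Ω^c_k (X ∩ Ω_k = `X ∖ Θ`), its printed properties PROVED (`torusTreeLenMod_le_torusTreeLen`: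
  *"In general d_M(X, mod Ω^c_k) ≤ d_M(X)"*; `torusTreeLenMod_eq_of_disjoint`: *"If X ⊂ Ω_k then d_M(X, mod Ω^c_k) =
  d_M(X)"*), the class 𝒟_k(mod Ω^c) typed component-free (`DMod`, reading (iv) below); and **LEMMA 16 PROVED**
  (`lemma16`): for finite families 𝒯 (the Θ_γ), 𝒳 (the X_α) of localization domains in `U` and 𝒴 (the Y_σ) of
  localization domains in `U` not inside `Θ := ⋃𝒯`, with `⋃𝒯 ∪ ⋃𝒳 ∪ ⋃𝒴 = U` a localization domain,
  `d(U) + 2 ≤ Σ_𝒯 (d(T) + 2) + Σ_𝒳 (d(X) + 2) + Σ_𝒴 (d(Y, mod Θ) + 2)` — by the printed mechanism (the target families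
  `Θ_γ`, `X_α`, `Y_σ ∖ Θ` cover `U`, *"cubes in Y_σ ∩ Θ are included because of Θ, not Y_σ"*; glue near-optimal graphs;
  a glued graph meeting all cubes of `U` inside `π⁻¹(U)` is admissible for `U`).
* Part 3 — HYPOTHESIS SHAPES on the final torus (`d = 3`, `n` cubes per direction, as in the sibling module; nothing
  asserted): the index sets `polymersIn U`, `modPolymersAt Θ □`, `modPolymersIn U Θ`; (snow)/(sumsum) for the torus
  `d_M(·, mod ·)` (`SummingMod n κ₀ K`); the summand `under2Weight` and **(under2)** (`Under2Bound n 𝒦 C λ β κ′ n₀`) with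
  a RELAXED index set (reading (iii) below: weaker than the printed hypothesis).
* Part 4 — PROVED: the free resummation `Σ_{𝒳⊆P} Π a = Π (1 + a) ≤ e^{Σ a}` (`sum_powerset_prod_le_exp`, the finite
  form of the printed `Σ_N (1/N!) Σ_{sequences}` estimate); the TERMWISE extraction `under2Weight_le` ((under2) →
  (under3) by Lemma 16: `λ^{β/2} e^{−(κ′−κ₀) d(U)}` times the reduced weights); the polymer sums `sum_polymersIn_exp_le`
  (*"Using Σ_{X⊂U} exp(−κ₀ d_M(X)) ≤ 𝒪(1)|U|_M"*, from (summing0) — DISCHARGED by pv22 via the sibling's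
  `summing0_of_kappa₀_le`) and `sum_modPolymersIn_exp_le` (the `Y`-sum through the cubes of `U − Θ`, from the (snow)
  shape); **`tootBound_of_under2`**: (under2) ∧ (snow) ⇒ (toot) with rate `κ′ − κ₀` and explicit `𝒪(1) = K₀(32,6)(1 + C) +
  C K₁`; and the composite **`stability_of_under2`**: (stingray) ∧ (under2) ∧ (snow) ⇒ Corollary 1, by this lineage's
  `stability_of_toot` — [Dimock2013BalabanIII] §3.6 is thereby kernel-checked over the cell's polymer model from (under2)
  ∧ (stingray) on.

**Readings / divergences (declared).**  (i) JOINING COST 2, NOT 1: the printed proof of Lemma 16 joins two member trees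
by *"a line between the two points in □ which are vertices of the trees"* of length ≤ M, □ *"a cube in the
intersection"* (TeX L2378–2380).  For a pair (Y_σ, Θ_γ) — and for two Y's meeting only inside Θ — the common cubes lie in
Θ, where τ_σ (which meets only the cubes of Y_σ ∩ Θ^c) need not have a vertex; the kernel proof joins instead through a
frontier WALL of the growing union (`exists_tfrontier` of pv22; one segment to the wall, one beyond: cost ≤ 2, sup
metric), as pv22 does for (2.27).  Hence `+2` per member where the print has `+1` — a constant, immaterial downstream
(Dimock-internal remark for the cell's T-G22 list; records only).  (ii) CONSTANTS: extracting `e^{−(κ′−κ₀) d_M(U)}` by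
Lemma 16 leaves a factor `e^{2(κ′−κ₀)}` (print: `e^{κ′−κ₀}`) per member but one; in print these are 𝒪(1) by the
convention of [Dimock2013BalabanIII] TeX L387 (*"𝒪(1) stands for a generic constant independent of all parameters"*; κ, κ₀
are such constants) and sit inside the 𝒪(1) of (under3); HERE they are absorbed by the spare half-powers `λ^{β/2}` under
the displayed smallness `λ^{β/2} e^{2(κ′−κ₀)} ≤ 1` (λ small depending on κ′ — within *"let λ be sufficiently small"* of
Theorem 2), so that the constants of (under3) stay `C` and the final 𝒪(1) of (toot) is `K₀(32,6)(1 + C) + C K₁`.  (iii)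
INDEX SET OF (under2): typed LARGER than printed — 𝒯 = any finite set of polymers in U (print: the component family of
Θ = Λ^c_{𝖭+1}), 𝒳 = any finite set of polymers in U (print: X_α ⊂ Θ^c), 𝒴 ⊆ `modPolymersIn U (⋃𝒯)`, constraint `⋃𝒯 ∪ ⋃𝒳
∪ ⋃𝒴 = U` only (print: *"→ U"* = union U AND connected through common cubes) — each relaxation enlarges a sum of
non-negative terms, so the printed (under2) implies the typed one (a WEAKER hypothesis); (under3)'s own *"drop all
restrictions … except"* (TeX L2404–2406) is the same move.  (iv) 𝒟_k(mod Ω^c) COMPONENT-FREE: *"for all α either Ω^c_{k,α}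
⊂ X or Ω^c_{k,α}, X are disjoint"* (components through common walls, [Dimock2013] §3.1 L1165–1168) is typed as "X ∩ Θ is
closed under wall-adjacency inside Θ" (`DMod`), equivalent for finite families (a subset of Θ closed under Θ-adjacency
steps is a union of adjacency components); the equivalence itself is not formalised — `DMod` only enters the index sets
of the hypothesis shapes.  (v) The cell's torus-model conventions D-pv22.1 / D-pv22g2.1 (sup metric of
[Dimock2013BalabanII] App. E; connected polygonal graphs in place of trees; geometry in the universal cover; junk value 0
of the infima on empty classes) apply to `torusTreeLenMod` as to `torusTreeLen`.  (vi) `n₀` is kept an integer (Theorem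
1: *"a fixed integer n₀ ≥ 4"*, TeX L334) and `λ^{n₀} ≤ λ^β` is used under `β ≤ n₀`, `0 < λ ≤ 1` (print, TeX L324: *"for β <
1/4 − 10ε"*, so β < 1/4 − 10ε < n₀; v1 wrote «β < 1/4», cross-read advisory C-pv18g10-1 A1).

**What is NOT claimed.**  (under2) and (snow) are hypothesis shapes, not asserted; (snow) is NOT discharged on the torus
(unit b01's `B14.RelTreeLength` proves the window analogue on ℤ^d); §3.1–3.5 of [Dimock2013BalabanIII] ((stingray),
(under), Lemma 14 (ugh2), Lemma 15 (sushi)) and Theorem 1 are not typed here; attainment of the infima and the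
tree-versus-connected-graph equality are not proved (as in pv22).  Value = kernel closure of the template's end chain
over the cell's own tree-length model + one new typed notion of the template (d_M(·, mod ·) on the torus), NOT summit
progress (YM₄ on T⁴ / infinite volume / mass gap are elsewhere and out of scope).

Cell records: TEMPLATE.md §4.3 (row D3 §3.6), §15 (the polymer-geometry toolkit), §15.2 (kernel status); GAPS.md
C-tmpl13-1, C-tmpl13-3, C-tmpl13-4, C-tmpl14-2, C-tmpl14-3 (the sibling's and `Reblocking`'s certificates); unit `b2b-balaban-template` gen 15,
journal claim D3-LEMMA16-UNDER2-KERNEL.  NEW leaf; imports `…Dimock2011to13.Phi43PolymerRepresentation` (this lineage,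
p182971; through it pv22's `TreeLengthTorus` p177631 / `TreeLengthTorusGeometry` p177824 and this lineage's
`Phi43Stability` p175764); sub-namespace `…Dimock2011to13.ThreeSorted`; modifies nothing.  v1 = p183502 (cross-read:
cell GAPS.md C-pv18g10-1, ok — objections 0, DOCFIX none, advisories A1–A3 records-only); v1.1: + Part 4e = the
PRINT-CONSTANT form of (under2) ⇒ (toot) (`under2Weight_le_print`, `tootBound_of_under2_print`,
`stability_of_under2_print`: the gluing factor `e^{2(κ′−κ₀)}` kept inside the 𝒪(1) of (under3) as in print, no smallness
hypothesis; advisory A2) and the reading-(vi) gloss on β (advisory A1), append-only after the v1 declarations (v1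
declaration region byte-identical).  The (snow) shape `SummingMod` is discharged at `d = 3` by the sibling
`…Dimock2011to13.HoleSummability` (p184078, `summingMod_of_kappa₁_le`).
-/

noncomputable section

open Real Finset
open Literature.MathematicalPhysics.QuantumFieldTheory.Balaban1983to89
open Literature.MathematicalPhysics.QuantumFieldTheory.Balaban1983to89.B13ScaleTransfer
open Literature.MathematicalPhysics.QuantumFieldTheory.Balaban1983to89.TreeLength
open Literature.MathematicalPhysics.QuantumFieldTheory.Balaban1983to89.TreeLengthTorus
open Literature.MathematicalPhysics.QuantumFieldTheory.Balaban1983to89.TreeLengthTorusGeometry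
open Literature.MathematicalPhysics.QuantumFieldTheory.Balaban1983to89.B12TreeDecay (kappa₀ K₀ K₀_pos)

namespace Literature.MathematicalPhysics.QuantumFieldTheory.Dimock2011to13.ThreeSorted

variable {d N : ℕ}

/-! ## Part 1. Graphs in `π⁻¹(S)` meeting the cubes of a TARGET family `B`, joins, gluing, `coverLen` -/

/-- GRAPHS IN `π⁻¹(S)` MEETING A TARGET FAMILY `B` — the common generalisation of [Balaban1987RG1] p. 257 admissibility
(`TreeLengthTorus.TAdmissible X T` = `TCover X X T`, `tCover_self_iff`) and of the graphs defining the linear distance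
modulo holes of [Dimock2013BalabanII] §3.3, verbatim (TeX L1690–1693): *"where the infimum is over all continuuum [sic]
tree graphs τ contained in X and intersecting every M-cube in X ∩ Ω_k, and ℓ(τ) is the length of τ"*
(`TAdmissibleMod X Θ T` = `TCover X (X ∖ Θ) T`): in the universal cover (reading D-pv22g2.1 of the cell) a connected
polygonal graph contained in `liftCubes S` which meets at least one lift of every cube of `B`.  Introduced so that the
gluing argument of [Dimock2013BalabanIII] Lemma 16 can treat its three sorts of members uniformly.
[cite: Dimock2013BalabanII, §3.3 (arXiv:1212.5562v2 TeX L1688–1693)] -/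
structure TCover (S B : Finset (TPt d N)) (T : List (Seg d)) : Prop where
  /-- the (lifted) graph is connected -/
  connected : IsConnected (carrier T)
  /-- the graph is contained in S (its lift in π⁻¹(S)) -/
  subset : carrier T ⊆ liftCubes S
  /-- the graph meets (a lift of) every cube of the target family B -/
  meets : ∀ a ∈ B, ∃ x : Pt d, proj N x = a ∧ (carrier T ∩ cube x).Nonempty

/-- `TCover X X T` is unit pv22's `TAdmissible X T` ([Balaban1987RG1] p. 257: *"tree graphs contained in X and
intersecting all the cubes in X"*). [cite: Balaban1987RG1, p.257 (linear size d_j)] -/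
theorem tCover_self_iff {X : Finset (TPt d N)} {T : List (Seg d)} : TCover X X T ↔ TAdmissible X T :=
  ⟨fun h => ⟨h.connected, h.subset, h.meets⟩, fun h => ⟨h.connected, h.subset, h.meets⟩⟩

/-- Monotonicity: enlarging the ambient family or shrinking the target family keeps a graph admissible. [folklore] -/
theorem TCover.mono {S S' B B' : Finset (TPt d N)} {T : List (Seg d)} (h : TCover S B T) (hS : S ⊆ S')
    (hB : B' ⊆ B) : TCover S' B' T :=
  ⟨h.connected, h.subset.trans (liftCubes_mono hS), fun a ha => h.meets a (hB ha)⟩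

/-- An admissible graph for a localization domain `X ⊆ S` is a graph in `π⁻¹(S)` meeting the cubes of `X`. [folklore] -/
theorem tCover_of_tAdmissible {X S : Finset (TPt d N)} {T : List (Seg d)} (h : TAdmissible X T) (hXS : X ⊆ S) :
    TCover S X T :=
  (tCover_self_iff.2 h).mono hXS (Finset.Subset.refl X)

/-- The ambient family of a `TCover` graph is non-empty (the carrier is). [folklore] -/
theorem TCover.target_nonempty_of_carrier {S B : Finset (TPt d N)} {T : List (Seg d)} (h : TCover S B T) :
    S.Nonempty := by
  obtain ⟨p, hp⟩ := h.connected.nonempty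
  obtain ⟨x, hx, -⟩ := mem_liftCubes.1 (h.subset hp)
  exact ⟨proj N x, hx⟩

/-- DECK INVARIANCE (port of unit pv22's `TreeLengthTorusGeometry.tAdmissible_translate`): a deck-translate of a graph in
`π⁻¹(S)` meeting the cubes of `B` is another such graph. [cite: Balaban1987RG1, p.257 (linear size d_j)] -/
theorem TCover.translate {S B : Finset (TPt d N)} {T : List (Seg d)} (hT : TCover S B T) (k : Pt d) :
    TCover S B (T.map (transSeg (corner (period N k)))) := by
  have hc : Continuous fun z : RPt d => corner (period N k) + z := continuous_const.add continuous_id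
  refine ⟨?_, ?_, ?_⟩
  · rw [carrier_map_transSeg]
    exact hT.connected.image _ hc.continuousOn
  · rw [carrier_map_transSeg]
    rintro _ ⟨z, hz, rfl⟩
    exact add_mem_liftCubes k (hT.subset hz)
  · intro a ha
    obtain ⟨x, hxa, q, hqT, hqx⟩ := hT.meets a ha
    refine ⟨period N k + x, ?_, corner (period N k) + q, ?_, add_mem_cube hqx⟩
    · rw [add_comm, proj_add_period, hxa]
    · rw [carrier_map_transSeg]
      exact Set.mem_image_of_mem _ hqT

/-- RE-SHEETING (port of `TreeLengthTorusGeometry.exists_translate_meets`): if `x` is ANY lift of a target cube, some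
deck-translate of the graph (same length) meets the cube `x` itself. [cite: Balaban1987RG1, p.257 (linear size d_j)] -/
theorem TCover.exists_translate_meets {S B : Finset (TPt d N)} {T : List (Seg d)} (hT : TCover S B T)
    {a : TPt d N} (ha : a ∈ B) {x : Pt d} (hx : proj N x = a) :
    ∃ T', TCover S B T' ∧ len T' = len T ∧ (carrier T' ∩ cube x).Nonempty := by
  obtain ⟨x', hx'a, q, hqT, hqx'⟩ := hT.meets a ha
  obtain ⟨k, hk⟩ := exists_period_of_proj_eq (hx'a.trans hx.symm)
  refine ⟨T.map (transSeg (corner (period N k))), hT.translate k, len_map_transSeg _ _,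
    corner (period N k) + q, ?_, ?_⟩
  · rw [carrier_map_transSeg]
    exact Set.mem_image_of_mem _ hqT
  · rw [hk, add_comm x' (period N k)]
    exact add_mem_cube hqx'

/-- JOIN THROUGH A COMMON TARGET CUBE (port of `TreeLengthTorusGeometry.tAdmissible_join_common`): graphs meeting `A`
and `B`, with a cube `c ∈ A ∩ B` of `S`, glue — after re-sheeting — to a graph meeting `B ∪ A` at cost ≤ 1 (a segment
inside the common lift of `c`).  This is the joining step of the proof of [Dimock2013BalabanIII] Lemma 16, verbatim
(TeX L2378–2380): *"For every pair in the spanning tree take a cube □ in the intersection and introduce a line between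
the two points in □ which are vertices of the trees. This line has length ≤ M"*. [cite: Dimock2013BalabanIII, Lemma 16 (proof) (arXiv:1304.0705v1 TeX L2371–2385)] -/
theorem tCover_join_common {S A B : Finset (TPt d N)} {TA TB : List (Seg d)} (hA : TCover S A TA)
    (hB : TCover S B TB) {c : TPt d N} (hcA : c ∈ A) (hcB : c ∈ B) (hcS : c ∈ S) :
    ∃ T, TCover S (B ∪ A) T ∧ len T ≤ len TB + len TA + 1 := by
  obtain ⟨x, hxc, p, hpT, hpx⟩ := hA.meets c hcA
  obtain ⟨TB', hB', hlenB, q, hqT, hqx⟩ := hB.exists_translate_meets hcB hxc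
  refine ⟨TB' ++ ((q, p) :: TA), ⟨?_, ?_, ?_⟩, ?_⟩
  · rw [carrier_append, carrier_cons]
    refine IsConnected.union ⟨q, hqT, Set.mem_union_left _ (left_mem_segment ℝ q p)⟩ hB'.connected ?_
    exact IsConnected.union ⟨p, right_mem_segment ℝ q p, hpT⟩
      ((convex_segment q p).isConnected ⟨q, left_mem_segment ℝ q p⟩) hA.connected
  · rw [carrier_append, carrier_cons]
    refine Set.union_subset hB'.subset (Set.union_subset ?_ hA.subset)
    refine ((convex_cube x).segment_subset hqx hpx).trans (cube_subset_liftCubes ?_)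
    rw [hxc]
    exact hcS
  · intro a ha
    rw [carrier_append, carrier_cons]
    rcases Finset.mem_union.1 ha with ha | ha
    · obtain ⟨y, hy, r, hr, hry⟩ := hB'.meets a ha
      exact ⟨y, hy, r, Set.mem_union_left _ hr, hry⟩
    · obtain ⟨y, hy, r, hr, hry⟩ := hA.meets a ha
      exact ⟨y, hy, r, Set.mem_union_right _ (Set.mem_union_right _ hr), hry⟩
  · rw [len_append, len_cons, hlenB]
    change len TB + (dist q p + len TA) ≤ len TB + len TA + 1
    linarith [dist_le_one_of_mem_cube hqx hpx]

/-- JOIN THROUGH A COMMON WALL (port of `TreeLengthTorusGeometry.tAdmissible_join_adj`): graphs meeting `A` and `B`,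
with target cubes `a ∈ A`, `c ∈ B` of `S` having a common wall ON THE TORUS, glue to a graph meeting `B ∪ A` at cost
≤ 2 (lift the wall next to the met lift of `a`, re-sheet the other graph, one segment to the wall and one beyond).  Used
where Lemma 16's *"cube □ in the intersection"* is not visited by both trees (a `Y_σ` meeting a hole `Θ_γ` only inside
`Θ`, see the module docstring, DIVERGENCES (i)). [cite: Dimock2013BalabanIII, Lemma 16 (proof) (arXiv:1304.0705v1 TeX L2371–2385)] -/
theorem tCover_join_adj {S A B : Finset (TPt d N)} {TA TB : List (Seg d)} (hA : TCover S A TA)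
    (hB : TCover S B TB) {a c : TPt d N} (haA : a ∈ A) (hcB : c ∈ B) (hac : TAdj a c) (haS : a ∈ S)
    (hcS : c ∈ S) : ∃ T, TCover S (B ∪ A) T ∧ len T ≤ len TB + len TA + 2 := by
  obtain ⟨xa, hxa, p, hpT, hpa⟩ := hA.meets a haA
  rw [← hxa] at hac
  obtain ⟨y, hyc, hadj⟩ := exists_lift_adj hac
  obtain ⟨TB', hB', hlenB, q, hqT, hqy⟩ := hB.exists_translate_meets hcB hyc
  obtain ⟨w, hwa, hwy, -⟩ := exists_wall_point hadj hpa
  refine ⟨TB' ++ ((q, w) :: (w, p) :: TA), ⟨?_, ?_, ?_⟩, ?_⟩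
  · rw [carrier_append, carrier_cons, carrier_cons]
    have h3 : IsConnected (segment ℝ w p ∪ carrier TA) :=
      IsConnected.union ⟨p, right_mem_segment ℝ w p, hpT⟩
        ((convex_segment w p).isConnected ⟨w, left_mem_segment ℝ w p⟩) hA.connected
    have h2 : IsConnected (segment ℝ q w ∪ (segment ℝ w p ∪ carrier TA)) :=
      IsConnected.union ⟨w, right_mem_segment ℝ q w, Set.mem_union_left _ (left_mem_segment ℝ w p)⟩
        ((convex_segment q w).isConnected ⟨q, left_mem_segment ℝ q w⟩) h3
    exact IsConnected.union ⟨q, hqT, Set.mem_union_left _ (left_mem_segment ℝ q w)⟩ hB'.connected h2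
  · rw [carrier_append, carrier_cons, carrier_cons]
    refine Set.union_subset hB'.subset (Set.union_subset ?_ (Set.union_subset ?_ hA.subset))
    · refine ((convex_cube y).segment_subset hqy hwy).trans (cube_subset_liftCubes ?_)
      rw [hyc]
      exact hcS
    · refine ((convex_cube xa).segment_subset hwa hpa).trans (cube_subset_liftCubes ?_)
      rw [hxa]
      exact haS
  · intro b hb
    rw [carrier_append, carrier_cons, carrier_cons]
    rcases Finset.mem_union.1 hb with hb | hb
    · obtain ⟨z, hz, r, hr, hrz⟩ := hB'.meets b hb
      exact ⟨z, hz, r, Set.mem_union_left _ hr, hrz⟩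
    · obtain ⟨z, hz, r, hr, hrz⟩ := hA.meets b hb
      exact ⟨z, hz, r, Set.mem_union_right _ (Set.mem_union_right _ (Set.mem_union_right _ hr)), hrz⟩
  · rw [len_append, len_cons, len_cons, hlenB]
    change len TB + (dist q w + (dist w p + len TA)) ≤ len TB + len TA + 2
    linarith [dist_le_one_of_mem_cube hqy hwy, dist_le_one_of_mem_cube hwa hpa]

/-- GLUING INDUCTION (port of unit pv22's `TreeLengthTorusGeometry.exists_tAdmissible_glue` to target families): if the
target families `B ∈ D` (non-empty, contained in `S`) have torus-face-connected union, graphs in `π⁻¹(S)` meeting them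
glue to ONE graph in `π⁻¹(S)` meeting their union, of length ≤ Σ lengths + 2(|D| − 1) — [Dimock2013BalabanIII] proof of
Lemma 16, verbatim (TeX L2376–2383): *"Also consider the graph consisting of pairs from {Θ_γ}, {X_α}, {Y_σ} which
intersect. Consider a subgraph which is a spanning tree. … the number of lines is less than the number of elements in
{Θ_γ}, {Y_σ}, {X_α}. Now the tree τ formed from τ_σ, τ_γ, τ_α and the connecting lines has length ℓ(τ) ≤ M(Σ_γ
(d_M(Θ_γ) + 1) + Σ_α (d_M(X_α) + 1) + Σ_σ (d_M(Y_σ, mod Θ) + 1))"* (here: frontier walls of the union instead of a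
spanning tree of the intersection graph, joining cost ≤ 2). [cite: Dimock2013BalabanIII, Lemma 16 (proof) (arXiv:1304.0705v1 TeX L2371–2385)] -/
theorem exists_tCover_glue {S : Finset (TPt d N)} {D : Finset (Finset (TPt d N))} (hDS : ∀ B ∈ D, B ⊆ S)
    (hDne : ∀ B ∈ D, B.Nonempty) (hU : TFaceConnected (D.biUnion id))
    {f : Finset (TPt d N) → List (Seg d)} (hf : ∀ B ∈ D, TCover S B (f B)) :
    ∀ n : ℕ, ∀ G : Finset (Finset (TPt d N)), G ⊆ D → G.Nonempty → (D \ G).card = n →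
      (∃ T, TCover S (G.biUnion id) T ∧ len T ≤ ∑ B ∈ G, len (f B) + 2 * ((G.card : ℝ) - 1)) →
      ∃ T, TCover S (D.biUnion id) T ∧ len T ≤ ∑ B ∈ D, len (f B) + 2 * ((D.card : ℝ) - 1) := by
  classical
  intro n
  induction n with
  | zero =>
    intro G hGD _ hcard hT
    have hGeq : G = D :=
      Finset.Subset.antisymm hGD (Finset.sdiff_eq_empty_iff_subset.1 (Finset.card_eq_zero.1 hcard))
    subst hGeq
    exact hT
  | succ n ih =>
    intro G hGD hGne hcard hT
    obtain ⟨T, hT, hlen⟩ := hT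
    have hAU : G.biUnion id ⊆ D.biUnion id := Finset.biUnion_subset_biUnion_of_subset_left _ hGD
    have hUS : D.biUnion id ⊆ S := Finset.biUnion_subset.2 fun B hB => hDS B hB
    obtain ⟨Y', hY'D, hY'G, T₁, hT₁, hlen₁⟩ : ∃ Y' ∈ D, Y' ∉ G ∧
        ∃ T₁, TCover S (Y' ∪ G.biUnion id) T₁ ∧ len T₁ ≤ len (f Y') + len T + 2 := by
      by_cases hmeet : ∃ Y' ∈ D, Y' ∉ G ∧ ∃ c ∈ Y', c ∈ G.biUnion id
      · obtain ⟨Y', hY'D, hY'G, c, hcY', hcA⟩ := hmeet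
        obtain ⟨T₁, hT₁, hlen₁⟩ := tCover_join_common hT (hf Y' hY'D) hcA hcY' (hDS Y' hY'D hcY')
        exact ⟨Y', hY'D, hY'G, T₁, hT₁, by linarith⟩
      · push Not at hmeet
        have hne : (D \ G).Nonempty := by
          rw [← Finset.card_pos, hcard]
          exact Nat.succ_pos n
        obtain ⟨Y'', hY''⟩ := hne
        rw [Finset.mem_sdiff] at hY''
        obtain ⟨y, hy⟩ := hDne Y'' hY''.1
        have hyU : y ∈ D.biUnion id := Finset.mem_biUnion.2 ⟨Y'', hY''.1, hy⟩
        have hyA : y ∉ G.biUnion id := hmeet Y'' hY''.1 hY''.2 y hy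
        obtain ⟨Y₁, hY₁⟩ := hGne
        obtain ⟨x₀, hx₀⟩ := hDne Y₁ (hGD hY₁)
        have hx₀A : x₀ ∈ G.biUnion id := Finset.mem_biUnion.2 ⟨Y₁, hY₁, hx₀⟩
        obtain ⟨a, haA, c, hcU, hcA, hac⟩ := exists_tfrontier hAU hU hx₀A hyU hyA
        obtain ⟨Y', hY'D, hcY'⟩ := Finset.mem_biUnion.1 hcU
        have hY'G : Y' ∉ G := fun h => hcA (Finset.mem_biUnion.2 ⟨Y', h, hcY'⟩)
        obtain ⟨T₁, hT₁, hlen₁⟩ :=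
          tCover_join_adj hT (hf Y' hY'D) haA hcY' hac (hUS (hAU haA)) (hUS hcU)
        exact ⟨Y', hY'D, hY'G, T₁, hT₁, by linarith⟩
    have hsub : insert Y' G ⊆ D := Finset.insert_subset hY'D hGD
    have hcard' : (D \ insert Y' G).card = n := by
      rw [Finset.sdiff_insert, Finset.card_erase_of_mem (Finset.mem_sdiff.2 ⟨hY'D, hY'G⟩), hcard]
      simp
    refine ih (insert Y' G) hsub (Finset.insert_nonempty _ _) hcard' ⟨T₁, ?_, ?_⟩
    · rw [Finset.biUnion_insert]
      exact hT₁
    · rw [Finset.sum_insert hY'G, Finset.card_insert_of_notMem hY'G]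
      push_cast
      linarith

/-- Graph form of the gluing: for a non-empty finite family `D` of non-empty target families in `S` with
torus-face-connected union, graphs `f B` meeting the members glue to a graph meeting `⋃ D` of length ≤ Σ_{B∈D} len(f B)
+ 2(|D| − 1). [cite: Dimock2013BalabanIII, Lemma 16 (proof) (arXiv:1304.0705v1 TeX L2371–2385)] -/
theorem exists_tCover_biUnion {S : Finset (TPt d N)} {D : Finset (Finset (TPt d N))} (hD : D.Nonempty)
    (hDS : ∀ B ∈ D, B ⊆ S) (hDne : ∀ B ∈ D, B.Nonempty) (hU : TFaceConnected (D.biUnion id))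
    {f : Finset (TPt d N) → List (Seg d)} (hf : ∀ B ∈ D, TCover S B (f B)) :
    ∃ T, TCover S (D.biUnion id) T ∧ len T ≤ ∑ B ∈ D, len (f B) + 2 * ((D.card : ℝ) - 1) := by
  obtain ⟨Y₁, hY₁⟩ := hD
  refine exists_tCover_glue hDS hDne hU hf _ {Y₁} (Finset.singleton_subset_iff.2 hY₁)
    (Finset.singleton_nonempty _) rfl ⟨f Y₁, ?_, ?_⟩
  · rw [Finset.singleton_biUnion]
    exact hf Y₁ hY₁
  · simp

/-- The set of lengths of the graphs in `π⁻¹(S)` meeting the target family `B`. [folklore] -/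
def coverLengths (S B : Finset (TPt d N)) : Set ℝ := {ℓ | ∃ T, TCover S B T ∧ len T = ℓ}

/-- The infimum of the lengths of the graphs in `π⁻¹(S)` meeting `B` (junk value `sInf ∅ = 0` on an empty class);
`coverLen X X = torusTreeLen X` (`torusTreeLen_eq_coverLen`) and `coverLen X (X ∖ Θ) = torusTreeLenMod X Θ`. [folklore] -/
def coverLen (S B : Finset (TPt d N)) : ℝ := sInf (coverLengths S B)

/-- Members of `coverLengths S B` are non-negative. [folklore] -/
theorem coverLengths_nonneg {S B : Finset (TPt d N)} {ℓ : ℝ} (h : ℓ ∈ coverLengths S B) : 0 ≤ ℓ := by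
  obtain ⟨T, -, rfl⟩ := h
  exact len_nonneg T

/-- `coverLengths S B` is bounded below (by 0). [folklore] -/
theorem bddBelow_coverLengths (S B : Finset (TPt d N)) : BddBelow (coverLengths S B) :=
  ⟨0, fun _ h => coverLengths_nonneg h⟩

/-- `0 ≤ coverLen S B`. [folklore] -/
theorem coverLen_nonneg (S B : Finset (TPt d N)) : 0 ≤ coverLen S B :=
  Real.sInf_nonneg fun _ h => coverLengths_nonneg h

/-- `coverLen S B` is at most the length of any graph of the class. [folklore] -/
theorem coverLen_le_len {S B : Finset (TPt d N)} {T : List (Seg d)} (h : TCover S B T) :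
    coverLen S B ≤ len T :=
  csInf_le (bddBelow_coverLengths S B) ⟨T, h, rfl⟩

/-- A lower bound of the lengths of all graphs of a non-empty class is a lower bound of `coverLen`. [folklore] -/
theorem le_coverLen {S B : Finset (TPt d N)} {a : ℝ} (hne : ∃ T, TCover S B T)
    (h : ∀ T, TCover S B T → a ≤ len T) : a ≤ coverLen S B := by
  obtain ⟨T₀, hT₀⟩ := hne
  refine le_csInf ⟨len T₀, T₀, hT₀, rfl⟩ ?_
  rintro _ ⟨T, hT, rfl⟩
  exact h T hT

/-- Near-optimal graphs: for every `ε > 0` there is one of length `< coverLen S B + ε`. [folklore] -/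
theorem exists_tCover_len_lt {S B : Finset (TPt d N)} (hne : ∃ T, TCover S B T) {ε : ℝ} (hε : 0 < ε) :
    ∃ T, TCover S B T ∧ len T < coverLen S B + ε := by
  obtain ⟨T₀, hT₀⟩ := hne
  obtain ⟨ℓ, ⟨T, hT, rfl⟩, hlt⟩ :=
    exists_lt_of_csInf_lt (s := coverLengths S B) ⟨len T₀, T₀, hT₀, rfl⟩ (lt_add_of_pos_right _ hε)
  exact ⟨T, hT, hlt⟩

/-- The admissible lengths of unit pv22 are the `coverLengths X X`. [folklore] -/
theorem tlengths_eq_coverLengths (X : Finset (TPt d N)) : tlengths X = coverLengths X X := by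
  ext ℓ
  simp only [tlengths, coverLengths, Set.mem_setOf_eq, tCover_self_iff]

/-- `d_j(X̄) = coverLen X X`: the linear size of [Balaban1987RG1] p. 257 / [Dimock2013] `d_M` on the torus is the special
case target = ambient. [cite: Balaban1987RG1, p.257 (linear size d_j)] -/
theorem torusTreeLen_eq_coverLen (X : Finset (TPt d N)) : torusTreeLen X = coverLen X X := by
  rw [torusTreeLen, coverLen, tlengths_eq_coverLengths]

/-- `coverLen` decreases when the ambient family grows or the target family shrinks (on a non-empty class). [folklore] -/
theorem coverLen_mono {S S' B B' : Finset (TPt d N)} (hS : S ⊆ S') (hB : B' ⊆ B)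
    (hne : ∃ T, TCover S B T) : coverLen S' B' ≤ coverLen S B := by
  refine le_of_forall_pos_le_add fun ε hε => ?_
  obtain ⟨T, hT, hlt⟩ := exists_tCover_len_lt hne hε
  exact (coverLen_le_len (hT.mono hS hB)).trans hlt.le

/-- THE GLUING INEQUALITY FOR TARGET FAMILIES: for a non-empty finite family `D` of non-empty target families `B ⊆ S`
with non-empty classes and torus-face-connected union, `coverLen S (⋃D) + 2 ≤ Σ_{B∈D} (coverLen S B + 2)` — the
target-family form of unit pv22's `torusTreeLen_biUnion_add_two_le` ([Balaban1988RG2Cluster] (2.27) sharpened) and the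
engine of Lemma 16 below. [cite: Dimock2013BalabanIII, Lemma 16 (proof) (arXiv:1304.0705v1 TeX L2371–2385)] -/
theorem coverLen_biUnion_add_two_le {S : Finset (TPt d N)} {D : Finset (Finset (TPt d N))} (hD : D.Nonempty)
    (hDS : ∀ B ∈ D, B ⊆ S) (hDne : ∀ B ∈ D, B.Nonempty) (hcov : ∀ B ∈ D, ∃ T, TCover S B T)
    (hU : TFaceConnected (D.biUnion id)) :
    coverLen S (D.biUnion id) + 2 ≤ ∑ B ∈ D, (coverLen S B + 2) := by
  refine le_of_forall_pos_le_add fun ε hε => ?_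
  have hDpos : (0 : ℝ) < D.card := by exact_mod_cast Finset.card_pos.2 hD
  obtain ⟨δ, hδpos, hδ⟩ : ∃ δ : ℝ, 0 < δ ∧ (D.card : ℝ) * δ = ε :=
    ⟨ε / D.card, div_pos hε hDpos, by field_simp⟩
  have hch : ∀ B ∈ D, ∃ T, TCover S B T ∧ len T < coverLen S B + δ := fun B hB =>
    exists_tCover_len_lt (hcov B hB) hδpos
  choose! f hf hflen using hch
  obtain ⟨T, hT, hlen⟩ := exists_tCover_biUnion hD hDS hDne hU hf
  have h1 := coverLen_le_len hT
  have h2 : ∑ B ∈ D, len (f B) ≤ ∑ B ∈ D, (coverLen S B + δ) :=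
    Finset.sum_le_sum fun B hB => (hflen B hB).le
  rw [Finset.sum_add_distrib, Finset.sum_const, nsmul_eq_mul] at h2
  rw [Finset.sum_add_distrib, Finset.sum_const, nsmul_eq_mul]
  linarith

/-! ## Part 2. The linear distance modulo holes `d_M(X, mod Ω^c)` on the torus, and D3 Lemma 16 -/

/-- GRAPHS DEFINING THE LINEAR DISTANCE MODULO HOLES — [Dimock2013BalabanII] §3.3 "polymers", verbatim (TeX L1688–1693):
*"We associate with any X ∈ 𝒟_k(mod Ω^c_k) a linear distance d_M(X, mod Ω^c_k) on scale M defined by  M d_M(X, mod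
Ω^c_k) = inf_{τ on X} ℓ(τ)  where the infimum is over all continuuum [sic] tree graphs τ contained in X and intersecting
every M-cube in X ∩ Ω_k, and ℓ(τ) is the length of τ."* — on the cell's torus model: with `Θ` the family of cubes of
the holes Ω^c_k (so X ∩ Ω_k = `X ∖ Θ`), a connected polygonal graph in `π⁻¹(X)` meeting a lift of every cube of `X ∖ Θ`
(= `TCover X (X ∖ Θ) T`; conventions D-pv22.1 / D-pv22g2.1 as for `TAdmissible`). [cite: Dimock2013BalabanII, §3.3 (arXiv:1212.5562v2 TeX L1688–1693)] -/
def TAdmissibleMod (X Θ : Finset (TPt d N)) (T : List (Seg d)) : Prop := TCover X (X \ Θ) T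

/-- **d_M(X, mod Ω^c) ON THE TORUS** — [Dimock2013BalabanII] §3.3, verbatim (TeX L1688–1699): *"M d_M(X, mod Ω^c_k) =
inf_{τ on X} ℓ(τ) … Thus d_M(X, mod Ω^c_k) measures the size of the components of X ∩ Ω_k and the distances between
these components. But d_M(X, mod Ω^c_k) does not measure the bulk of X ∩ Ω_k^c. The idea is that decay in these
regions (holes) will be taken care of elsewhere."* — the infimum of the lengths of the `TAdmissibleMod X Θ` graphs (unit
cubes, no division by M; junk value 0 on an empty class).  It is the relative length in which [Dimock2013BalabanIII]
(under2)/Lemma 16/(under3) measure the boundary polymers `Y_σ`.  (Unit b01's `B14.RelTreeLength.relTreeLen X S` is the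
WINDOW analogue on ℤ^d for [Balaban1989LargeFieldII] (1.67); this is the periodic carrier.) [cite: Dimock2013BalabanII, §3.3 (arXiv:1212.5562v2 TeX L1688–1699)] -/
def torusTreeLenMod (X Θ : Finset (TPt d N)) : ℝ := coverLen X (X \ Θ)

/-- Unfolding of `TAdmissibleMod`. [folklore] -/
theorem tAdmissibleMod_iff {X Θ : Finset (TPt d N)} {T : List (Seg d)} :
    TAdmissibleMod X Θ T ↔ TCover X (X \ Θ) T := Iff.rfl

/-- Unfolding of `torusTreeLenMod`. [folklore] -/
theorem torusTreeLenMod_eq_coverLen (X Θ : Finset (TPt d N)) : torusTreeLenMod X Θ = coverLen X (X \ Θ) := rfl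

/-- An admissible graph for `X` (meeting ALL its cubes) is admissible modulo any holes. [folklore] -/
theorem TAdmissibleMod.of_tAdmissible {X : Finset (TPt d N)} {T : List (Seg d)} (h : TAdmissible X T)
    (Θ : Finset (TPt d N)) : TAdmissibleMod X Θ T :=
  (tCover_self_iff.2 h).mono (Finset.Subset.refl X) Finset.sdiff_subset

/-- `d_M(X, mod Ω^c) ≥ 0`. [cite: Dimock2013BalabanII, §3.3 (arXiv:1212.5562v2 TeX L1688–1693)] -/
theorem torusTreeLenMod_nonneg (X Θ : Finset (TPt d N)) : 0 ≤ torusTreeLenMod X Θ := coverLen_nonneg _ _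

/-- `d_M(X, mod Ω^c)` is at most the length of any graph of its class. [cite: Dimock2013BalabanII, §3.3 (arXiv:1212.5562v2 TeX L1688–1693)] -/
theorem torusTreeLenMod_le_len {X Θ : Finset (TPt d N)} {T : List (Seg d)} (h : TAdmissibleMod X Θ T) :
    torusTreeLenMod X Θ ≤ len T := coverLen_le_len h

/-- [Dimock2013BalabanII] §3.3, verbatim (TeX L1697–1698): *"If X ⊂ Ω_k then d_M(X, mod Ω^c_k) = d_M(X)"* — PROVED: if
`X` is disjoint from the holes then `X ∖ Θ = X` and the two classes of graphs coincide. [cite: Dimock2013BalabanII, §3.3 (arXiv:1212.5562v2 TeX L1697–1698)] -/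
theorem torusTreeLenMod_eq_of_disjoint {X Θ : Finset (TPt d N)} (h : Disjoint X Θ) :
    torusTreeLenMod X Θ = torusTreeLen X := by
  rw [torusTreeLenMod, Finset.sdiff_eq_self_of_disjoint h, torusTreeLen_eq_coverLen]

/-- **𝒟_k(mod Ω^c) — polymers with holes**, [Dimock2013BalabanII] §3.3, verbatim (TeX L1680–1687): *"A variation is a
polymer with holes. Given a final small field region Ω_k (not necessarily connected) on the same torus, suppose the
large field region Ω_k^c has connected components Ω^c_{k,α} (the holes). We define a subset of 𝒟_k by  𝒟_k(mod Ω^c_k)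
= {X ⊂ 𝒟_k : for all α either Ω^c_{k,α} ⊂ X or Ω^c_{k,α}, X are disjoint}"* — typed COMPONENT-FREE (READING, recorded
in the module docstring): with `Θ` the cubes of Ω^c_k and "connected" = through common walls ([Dimock2013] §3.1 TeX
L1165–1168, the cell's `TAdj`), "every component of Θ is contained in X or disjoint from X" is equivalent, for finite
families, to "X ∩ Θ is closed under wall-adjacency inside Θ", which is what is written here.  Only used inside the
hypothesis shapes `SummingMod` / `Under2Bound` (index sets), never as a proved property. [cite: Dimock2013BalabanII, §3.3 (arXiv:1212.5562v2 TeX L1680–1687)] -/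
def DMod (Θ X : Finset (TPt d N)) : Prop := ∀ a ∈ Θ, ∀ b ∈ Θ, TAdj a b → (a ∈ X ↔ b ∈ X)

/-- A polymer disjoint from the holes is in 𝒟_k(mod Ω^c) (all holes disjoint from it). [cite: Dimock2013BalabanII, §3.3 (arXiv:1212.5562v2 TeX L1680–1687)] -/
theorem dMod_of_disjoint {Θ X : Finset (TPt d N)} (h : Disjoint X Θ) : DMod Θ X := by
  intro a ha b hb _
  have ha' : a ∉ X := fun hx => Finset.disjoint_left.1 h hx ha
  have hb' : b ∉ X := fun hx => Finset.disjoint_left.1 h hx hb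
  simp [ha', hb']

/-- A polymer containing all the holes is in 𝒟_k(mod Ω^c). [cite: Dimock2013BalabanII, §3.3 (arXiv:1212.5562v2 TeX L1680–1687)] -/
theorem dMod_of_subset {Θ X : Finset (TPt d N)} (h : Θ ⊆ X) : DMod Θ X := by
  intro a ha b hb _
  simp [h ha, h hb]

section Periodic

variable [NeZero N]

/-- Every torus localization domain `X ⊆ S` has a graph in `π⁻¹(S)` meeting any sub-family `B ⊆ X` of its cubes (unit
pv22's `exists_tAdmissible`). [folklore] -/
theorem exists_tCover_of_dom {X S : Finset (TPt d N)} (hX : X.Nonempty) (hc : TFaceConnected X) (hXS : X ⊆ S)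
    {B : Finset (TPt d N)} (hB : B ⊆ X) : ∃ T, TCover S B T := by
  obtain ⟨T, hT, -⟩ := exists_tAdmissible hX hc
  exact ⟨T, (tCover_self_iff.2 hT).mono hXS hB⟩

/-- `coverLen S X ≤ d_j(X)` for a localization domain `X ⊆ S`. [folklore] -/
theorem coverLen_le_torusTreeLen {X S : Finset (TPt d N)} (hX : X.Nonempty) (hc : TFaceConnected X)
    (hXS : X ⊆ S) : coverLen S X ≤ torusTreeLen X := by
  rw [torusTreeLen_eq_coverLen]
  exact coverLen_mono hXS (Finset.Subset.refl X) (exists_tCover_of_dom hX hc (Finset.Subset.refl X)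
    (Finset.Subset.refl X))

/-- [Dimock2013BalabanII] §3.3, verbatim (TeX L1698–1699): *"In general d_M(X, mod Ω^c_k) ≤ d_M(X)."* — PROVED for
localization domains `X` of the torus (every admissible graph is admissible modulo the holes). [cite: Dimock2013BalabanII, §3.3 (arXiv:1212.5562v2 TeX L1698–1699)] -/
theorem torusTreeLenMod_le_torusTreeLen {X : Finset (TPt d N)} (hX : X.Nonempty) (hc : TFaceConnected X)
    (Θ : Finset (TPt d N)) : torusTreeLenMod X Θ ≤ torusTreeLen X := by
  rw [torusTreeLenMod, torusTreeLen_eq_coverLen]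
  exact coverLen_mono (Finset.Subset.refl X) Finset.sdiff_subset
    (exists_tCover_of_dom hX hc (Finset.Subset.refl X) (Finset.Subset.refl X))

/-- `coverLen S (Y ∖ Θ) ≤ d_M(Y, mod Θ)` for a localization domain `Y ⊆ S`: a graph confined to `Y` is a graph in
`S`. [folklore] -/
theorem coverLen_sdiff_le_torusTreeLenMod {Y S : Finset (TPt d N)} (hY : Y.Nonempty) (hc : TFaceConnected Y)
    (hYS : Y ⊆ S) (Θ : Finset (TPt d N)) : coverLen S (Y \ Θ) ≤ torusTreeLenMod Y Θ :=
  coverLen_mono hYS (Finset.Subset.refl _) (exists_tCover_of_dom hY hc (Finset.Subset.refl Y) Finset.sdiff_subset)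

/-- A sum of non-negative terms over a union is at most the sum of the two sums. [folklore] -/
theorem sum_union_le_add {α : Type*} [DecidableEq α] {s t : Finset α} {f : α → ℝ} (hf : ∀ x, 0 ≤ f x) :
    ∑ x ∈ s ∪ t, f x ≤ ∑ x ∈ s, f x + ∑ x ∈ t, f x := by
  have h := Finset.sum_union_inter (s₁ := s) (s₂ := t) (f := f)
  have h0 : 0 ≤ ∑ x ∈ s ∩ t, f x := Finset.sum_nonneg fun x _ => hf x
  linarith

/-- **[Dimock2013BalabanIII] LEMMA 16, PROVED ON THE TORUS** (the 16th `\begin{lem}` of arXiv:1304.0705v1, TeX L2362, under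
the global counter `\newtheorem{lem}{Lemma}` L16; unlabelled), verbatim (TeX L2362–2369): *"Σ_ℓ (d_M(Θ_ℓ) + 1) + Σ_α
(d_M(X_α) + 1) + Σ_σ (d_M(Y_σ, mod Θ) + 1) ≥ d_M(U)"* [sic: ℓ for γ], for the three sorts of members of a term of
(under2) — the components `Θ_γ` of `Θ`, the small-field polymers `X_α` and the boundary polymers `Y_σ` (measured modulo
`Θ = ∪_γ Θ_γ`) — whose union is the connected `U` (TeX L1508–1510: *"Let U be the union of {Θ_γ}, {Y_σ}, {X_α} … where
now we say X, Y are connected if they have a cube □ in common"*).  Printed proof (TeX L2371–2385): minimal trees `τ_σ`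
(*"intersecting every cube in Y_σ ∩ Θ^c of length ℓ(τ_σ) = M d_M(Y_σ, mod Θ)"*), `τ_γ`, `τ_α`, glued along a spanning
tree of the intersection graph by lines of length ≤ M; *"But τ spans all cubes in U (cubes in Y_σ ∩ Θ are included
because of Θ, not Y_σ) and so ℓ(τ) ≥ M d_M(U) which gives the result."*  HERE, in the cell's conventions (unit pv22:
joins cost ≤ 2, cf. `TreeLengthTorusGeometry.torusTreeLen_biUnion_add_two_le` = [Balaban1988RG2Cluster] (2.27) with 2
in place of 5): `d(U) + 2 ≤ Σ_{T∈𝒯} (d(T) + 2) + Σ_{X∈𝒳} (d(X) + 2) + Σ_{Y∈𝒴} (d(Y, mod Θ) + 2)`, `Θ := ⋃𝒯`, for finite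
families 𝒯, 𝒳 of localization domains in `U` and 𝒴 of localization domains in `U` not contained in `Θ`, with `⋃𝒯 ∪ ⋃𝒳 ∪
⋃𝒴 = U` a localization domain — WEAKER HYPOTHESES than the printed index set (no disjointness of the `Θ_γ`, no `X_α ⊂
Θ^c`, no `Y_σ ∈ 𝒟_𝖭(mod Θ)`, no overlap-connectedness: only the union).  Mechanism as printed: the target families
`Θ_γ`, `X_α`, `Y_σ ∖ Θ` cover `U` (*"because of Θ, not Y_σ"*), near-optimal graphs of the members are glued by
`coverLen_biUnion_add_two_le`, and a glued graph meeting every cube of `U` inside `π⁻¹(U)` has length ≥ d(U). [cite: Dimock2013BalabanIII, Lemma 16 (arXiv:1304.0705v1 TeX L2362–2385)] -/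
theorem lemma16 {U : Finset (TPt d N)} (hUne : U.Nonempty) (hU : TFaceConnected U)
    {𝒯 𝒳 𝒴 : Finset (Finset (TPt d N))}
    (h𝒯 : ∀ T ∈ 𝒯, T.Nonempty ∧ TFaceConnected T ∧ T ⊆ U)
    (h𝒳 : ∀ X ∈ 𝒳, X.Nonempty ∧ TFaceConnected X ∧ X ⊆ U)
    (h𝒴 : ∀ Y ∈ 𝒴, Y.Nonempty ∧ TFaceConnected Y ∧ Y ⊆ U ∧ ¬ Y ⊆ 𝒯.biUnion id)
    (hcover : 𝒯.biUnion id ∪ 𝒳.biUnion id ∪ 𝒴.biUnion id = U) :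
    torusTreeLen U + 2 ≤ ∑ T ∈ 𝒯, (torusTreeLen T + 2) + ∑ X ∈ 𝒳, (torusTreeLen X + 2)
      + ∑ Y ∈ 𝒴, (torusTreeLenMod Y (𝒯.biUnion id) + 2) := by
  classical
  set Θ := 𝒯.biUnion id with hΘ
  set D : Finset (Finset (TPt d N)) := 𝒯 ∪ 𝒳 ∪ 𝒴.image (· \ Θ) with hD
  -- the union of the target families is U
  have hDU : D.biUnion id = U := by
    apply Finset.Subset.antisymm
    · intro x hx
      obtain ⟨B, hB, hxB⟩ := Finset.mem_biUnion.1 hx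
      rcases Finset.mem_union.1 hB with hB | hB
      · rcases Finset.mem_union.1 hB with hB | hB
        · exact (h𝒯 B hB).2.2 hxB
        · exact (h𝒳 B hB).2.2 hxB
      · obtain ⟨Y, hY, rfl⟩ := Finset.mem_image.1 hB
        exact (h𝒴 Y hY).2.2.1 (Finset.mem_sdiff.1 hxB).1
    · intro x hx
      rw [← hcover] at hx
      rcases Finset.mem_union.1 hx with hx | hx
      · rcases Finset.mem_union.1 hx with hx | hx
        · obtain ⟨T, hT, hxT⟩ := Finset.mem_biUnion.1 hx
          exact Finset.mem_biUnion.2 ⟨T, by simp [hD, hT], hxT⟩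
        · obtain ⟨X, hX, hxX⟩ := Finset.mem_biUnion.1 hx
          exact Finset.mem_biUnion.2 ⟨X, by simp [hD, hX], hxX⟩
      · obtain ⟨Y, hY, hxY⟩ := Finset.mem_biUnion.1 hx
        by_cases hxΘ : x ∈ Θ
        · obtain ⟨T, hT, hxT⟩ := Finset.mem_biUnion.1 hxΘ
          exact Finset.mem_biUnion.2 ⟨T, by simp [hD, hT], hxT⟩
        · refine Finset.mem_biUnion.2 ⟨Y \ Θ, ?_, Finset.mem_sdiff.2 ⟨hxY, hxΘ⟩⟩
          simp only [hD, Finset.mem_union, Finset.mem_image]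
          exact Or.inr ⟨Y, hY, rfl⟩
  have hDne : D.Nonempty := by
    by_contra h
    rw [Finset.not_nonempty_iff_eq_empty] at h
    rw [h, Finset.biUnion_empty] at hDU
    exact hUne.ne_empty hDU.symm
  have hDS : ∀ B ∈ D, B ⊆ U := by
    intro B hB
    rw [← hDU]
    exact Finset.subset_biUnion_of_mem id hB
  have hmem : ∀ B ∈ D, B.Nonempty ∧ ∃ T, TCover U B T := by
    intro B hB
    rcases Finset.mem_union.1 hB with hB' | hB'
    · rcases Finset.mem_union.1 hB' with hB' | hB'
      · obtain ⟨h1, h2, h3⟩ := h𝒯 B hB'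
        exact ⟨h1, exists_tCover_of_dom h1 h2 h3 (Finset.Subset.refl B)⟩
      · obtain ⟨h1, h2, h3⟩ := h𝒳 B hB'
        exact ⟨h1, exists_tCover_of_dom h1 h2 h3 (Finset.Subset.refl B)⟩
    · obtain ⟨Y, hY, rfl⟩ := Finset.mem_image.1 hB'
      obtain ⟨h1, h2, h3, h4⟩ := h𝒴 Y hY
      refine ⟨?_, exists_tCover_of_dom h1 h2 h3 Finset.sdiff_subset⟩
      obtain ⟨y, hyY, hyΘ⟩ := Finset.not_subset.1 h4
      exact ⟨y, Finset.mem_sdiff.2 ⟨hyY, hyΘ⟩⟩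
  have hUD : TFaceConnected (D.biUnion id) := by rw [hDU]; exact hU
  have hglue := coverLen_biUnion_add_two_le hDne hDS (fun B hB => (hmem B hB).1) (fun B hB => (hmem B hB).2) hUD
  rw [hDU] at hglue
  rw [torusTreeLen_eq_coverLen]
  -- split the sum over D into the three sorts
  have hg0 : ∀ B : Finset (TPt d N), 0 ≤ coverLen U B + 2 := fun B => by
    linarith [coverLen_nonneg U B]
  have hsplit : ∑ B ∈ D, (coverLen U B + 2) ≤ ∑ B ∈ 𝒯, (coverLen U B + 2) + ∑ B ∈ 𝒳, (coverLen U B + 2)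
      + ∑ B ∈ 𝒴.image (· \ Θ), (coverLen U B + 2) := by
    calc ∑ B ∈ D, (coverLen U B + 2)
        ≤ ∑ B ∈ 𝒯 ∪ 𝒳, (coverLen U B + 2) + ∑ B ∈ 𝒴.image (· \ Θ), (coverLen U B + 2) :=
          sum_union_le_add hg0
      _ ≤ _ := by linarith [sum_union_le_add (s := 𝒯) (t := 𝒳) hg0]
  have hT : ∑ B ∈ 𝒯, (coverLen U B + 2) ≤ ∑ T ∈ 𝒯, (torusTreeLen T + 2) :=
    Finset.sum_le_sum fun T hT => by
      linarith [coverLen_le_torusTreeLen (h𝒯 T hT).1 (h𝒯 T hT).2.1 (h𝒯 T hT).2.2]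
  have hX : ∑ B ∈ 𝒳, (coverLen U B + 2) ≤ ∑ X ∈ 𝒳, (torusTreeLen X + 2) :=
    Finset.sum_le_sum fun X hX => by
      linarith [coverLen_le_torusTreeLen (h𝒳 X hX).1 (h𝒳 X hX).2.1 (h𝒳 X hX).2.2]
  have hY : ∑ B ∈ 𝒴.image (· \ Θ), (coverLen U B + 2) ≤ ∑ Y ∈ 𝒴, (torusTreeLenMod Y Θ + 2) :=
    calc ∑ B ∈ 𝒴.image (· \ Θ), (coverLen U B + 2)
        ≤ ∑ Y ∈ 𝒴, (coverLen U (Y \ Θ) + 2) := Finset.sum_image_le_of_nonneg fun B _ => hg0 B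
      _ ≤ ∑ Y ∈ 𝒴, (torusTreeLenMod Y Θ + 2) := Finset.sum_le_sum fun Y hY => by
          linarith [coverLen_sdiff_le_torusTreeLenMod (h𝒴 Y hY).1 (h𝒴 Y hY).2.1 (h𝒴 Y hY).2.2.1 Θ]
  linarith

end Periodic



/-! ## Part 3. (under2) and (snow) as hypothesis shapes on the final torus (`d = 3`, `n` cubes per direction) -/

section Resummation

variable {n : ℕ} [NeZero n]

/-- The `M`-polymers CONTAINED IN `U` (index set of the `Θ_γ` and `X_α` after [Dimock2013BalabanIII] TeX L2404–2406: *"Now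
drop all restrictions on Θ_γ, X_α, Y_σ except that they are contained in U …"*). [cite: Dimock2013BalabanIII, §3.6 (arXiv:1304.0705v1 TeX L2404–2406)] -/
def polymersIn (U : Finset (TPt 3 n)) : Finset (Finset (TPt 3 n)) := (polymers n).filter (· ⊆ U)

/-- Membership in `polymersIn U`. [folklore] -/
theorem mem_polymersIn {U X : Finset (TPt 3 n)} :
    X ∈ polymersIn U ↔ (X.Nonempty ∧ TFaceConnected X) ∧ X ⊆ U := by
  rw [polymersIn, Finset.mem_filter, mem_polymers]

/-- The polymers with holes THROUGH a cube `□`: the index set of (snow)/(sumsum), [Dimock2013BalabanII] verbatim (TeX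
L1701–1704): *"Σ_{X ∈ 𝒟_k(mod Ω^c_k), X ⊃ □} e^{−κ₀ d_M(X mod Ω^c_k)} ≤ K₀"* — polymers `Y ∋ c` with `DMod Θ Y`. [cite: Dimock2013BalabanII, §3.3 eq. (snow) (arXiv:1212.5562v2 TeX L1700–1704)] -/
def modPolymersAt (Θ : Finset (TPt 3 n)) (c : TPt 3 n) : Finset (Finset (TPt 3 n)) := by
  classical exact (polymers n).filter fun Y => c ∈ Y ∧ DMod Θ Y

/-- Membership in `modPolymersAt Θ c`. [folklore] -/
theorem mem_modPolymersAt {Θ Y : Finset (TPt 3 n)} {c : TPt 3 n} :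
    Y ∈ modPolymersAt Θ c ↔ (Y.Nonempty ∧ TFaceConnected Y) ∧ c ∈ Y ∧ DMod Θ Y := by
  classical
  unfold modPolymersAt
  rw [Finset.mem_filter, mem_polymers]

/-- The index set of the boundary polymers `Y_σ` of (under2)/(under3) — [Dimock2013BalabanIII] TeX L1469–1471: *"over
distinct {Y_σ} satisfying Y_σ # Θ and Y_σ ∈ 𝒟_𝖭(mod Θ)"* (`#` = *"intersects both"*, Theorem 1 item 7, TeX L347: *"where X # Λ_k means X intersects both Λ_k and Λ_k^c"*) and TeX
L2404–2406: *"except that they are contained in U and for Θ = ∪_γ Θ_γ that Y_σ # Θ and Y_σ ∈ 𝒟_𝖭(mod Θ)"*: polymers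
`Y ⊆ U` meeting `Θ`, not contained in `Θ`, with `DMod Θ Y`. [cite: Dimock2013BalabanIII, §3.6 (arXiv:1304.0705v1 TeX L2404–2406)] -/
def modPolymersIn (U Θ : Finset (TPt 3 n)) : Finset (Finset (TPt 3 n)) := by
  classical exact (polymers n).filter fun Y => Y ⊆ U ∧ (Y ∩ Θ).Nonempty ∧ ¬ Y ⊆ Θ ∧ DMod Θ Y

/-- Membership in `modPolymersIn U Θ`. [folklore] -/
theorem mem_modPolymersIn {U Θ Y : Finset (TPt 3 n)} :
    Y ∈ modPolymersIn U Θ ↔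
      (Y.Nonempty ∧ TFaceConnected Y) ∧ Y ⊆ U ∧ (Y ∩ Θ).Nonempty ∧ ¬ Y ⊆ Θ ∧ DMod Θ Y := by
  classical
  unfold modPolymersIn
  rw [Finset.mem_filter, mem_polymers]

/-- **(snow) = [Dimock2013BalabanII] Lemma E.3 (sumsum), as a hypothesis shape for the torus `d_M(·, mod ·)`** — verbatim
(TeX L1700–1705): *"For any M-cube □ ∈ Ω_k we have for a universal constants [sic] κ₀, K₀:  Σ_{X ∈ 𝒟_k(mod Ω^c_k), X ⊃
□} e^{−κ₀ d_M(X mod Ω^c_k)} ≤ K₀.  See appendix E for the proof."*; App. E Lemma E.3 (TeX L6914–6920): *"Let Ω be a union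
of M-cubes. For □ ⊂ Ω and constants κ₀, K₀ = 𝒪(1):  Σ_{X ∈ 𝒟_k(mod Ω^c), X ⊃ □} exp(−κ₀ d_M(X, mod Ω^c)) ≤ K₀"* (a
PUBLISHED, PROVED lemma — proof TeX L6923–6955 via Lemmas E.1–E.2; it is the input used at [Dimock2013BalabanIII] TeX
L2429–2436).  Typed: for every hole family `Θ` and every cube `c ∉ Θ`, `Σ_{Y ∈ modPolymersAt Θ c} e^{−κ₀ d(Y, mod Θ)} ≤ K`.
NOT discharged here (unit b01's `B14.RelTreeLength.Window.sumsum` proves the WINDOW analogue on ℤ^d by a relative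
Steiner-animal count; the periodic carrier would need the same count through the covering map). [cite: Dimock2013BalabanII, §3.3 eq. (snow) and App. E Lemma E.3 eq. (sumsum) (arXiv:1212.5562v2 TeX L1700–1705, L6914–6920)] -/
def SummingMod (n : ℕ) [NeZero n] (κ₀ K : ℝ) : Prop :=
  ∀ Θ : Finset (TPt 3 n), ∀ c : TPt 3 n, c ∉ Θ →
    ∑ Y ∈ modPolymersAt Θ c, exp (-κ₀ * torusTreeLenMod Y Θ) ≤ K

/-- The SUMMAND of (under2) for the triple (𝒯 = {Θ_γ}, 𝒳 = {X_α}, 𝒴 = {Y_σ}), [Dimock2013BalabanIII] verbatim (TeX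
L2353–2356): *"Π_γ λ^{n₀} e^{−κ′ d_M(Θ_γ)} Π_α 𝒪(1) λ^β e^{−κ′ d_M(X_α)} Π_σ 𝒪(1) λ^β e^{−κ′ d_M(Y_σ, mod Θ)}"* with 𝒪(1)
displayed as `C`, `Θ := ⋃𝒯`, `d_M := torusTreeLen`, `d_M(·, mod Θ) := torusTreeLenMod · Θ`. [cite: Dimock2013BalabanIII, §3.6 eq. (under2) (arXiv:1304.0705v1 TeX L2349–2358)] -/
def under2Weight (C lam β κ' : ℝ) (n₀ : ℕ) (𝒯 𝒳 𝒴 : Finset (Finset (TPt 3 n))) : ℝ :=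
  (∏ T ∈ 𝒯, lam ^ n₀ * exp (-(κ' * torusTreeLen T))) *
    (∏ X ∈ 𝒳, C * lam ^ β * exp (-(κ' * torusTreeLen X))) *
    ∏ Y ∈ 𝒴, C * lam ^ β * exp (-(κ' * torusTreeLenMod Y (𝒯.biUnion id)))

/-- **(under2) as a hypothesis shape** — [Dimock2013BalabanIII] §3.6, verbatim (TeX L2349–2358): *"We return to the
estimate on 𝒦(U) where U ∈ 𝒟_𝖭 is a connected union of M cubes in 𝕋^{−𝖭}_𝖬. Substitute the bound on 𝒦′(Θ) into the
bound (under) on 𝒦(U) and find  |𝒦(U)| ≤ Σ_{{Θ_γ},{Y_σ},{X_α} → U} Π_γ λ^{n₀} e^{−κ′ d_M(Θ_γ)} Π_α 𝒪(1) λ^β e^{−κ′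
d_M(X_α)} Π_σ 𝒪(1) λ^β e^{−κ′ d_M(Y_σ, mod Θ)}"*, where (TeX L1469–1471) *"The sum … is over disjoint Θ_γ, over distinct
{X_α} satisfying X_α ⊂ Θ^c and over distinct {Y_σ} satisfying Y_σ # Θ and Y_σ ∈ 𝒟_𝖭(mod Θ)"* and *"→ U"* (TeX
L1508–1512) means that `U` is the union, connected through common cubes.  TYPED WITH A RELAXED INDEX SET (every
relaxation ENLARGES the non-negative majorant, so the printed (under2) IMPLIES this shape — it is a weaker hypothesis):
𝒯 ranges over ALL finite sets of polymers in `U` (in print: the component decomposition of some Θ), 𝒳 over all finite sets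
of polymers in `U` (in print: also `X_α ⊂ Θ^c`), 𝒴 over the finite subsets of `modPolymersIn U (⋃𝒯)`, subject only to
`⋃𝒯 ∪ ⋃𝒳 ∪ ⋃𝒴 = U` (in print: also overlap-connected).  NOT asserted: it is the output of §3.1–3.5 ((under), Lemma 15
(sushi)). [cite: Dimock2013BalabanIII, §3.6 eq. (under2) (arXiv:1304.0705v1 TeX L2349–2358)] -/
def Under2Bound (n : ℕ) [NeZero n] (K : TDom 3 n → ℝ) (C lam β κ' : ℝ) (n₀ : ℕ) : Prop :=
  ∀ U : TDom 3 n,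
    |K U| ≤ ∑ 𝒯 ∈ (polymersIn U.1).powerset, ∑ 𝒳 ∈ (polymersIn U.1).powerset,
      ∑ 𝒴 ∈ (modPolymersIn U.1 (𝒯.biUnion id)).powerset,
        if 𝒯.biUnion id ∪ 𝒳.biUnion id ∪ 𝒴.biUnion id = U.1 then under2Weight C lam β κ' n₀ 𝒯 𝒳 𝒴
        else 0

/-! ## Part 4. PROVED: (under2) ⇒ (under3) ⇒ (toot), and (stingray) ∧ (under2) ⇒ Corollary 1 -/

/-! ### 4a. Elementary summation lemmas -/

omit [NeZero n] in
/-- THE FREE RESUMMATION: `Σ_{𝒳 ⊆ P} Π_{X∈𝒳} a(X) = Π_{X∈P} (1 + a(X)) ≤ exp(Σ_{X∈P} a(X))` for `a ≥ 0` — the exact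
finite form of [Dimock2013BalabanIII] TeX L2419–2428 (*"≤ Σ_{N=0}^∞ (1/N!) Σ_{(X_1,…,X_n)} Π_i 𝒪(1) λ^{β/2} e^{−κ d_M(X_i)}
≤ Σ_N (1/N!)(𝒪(1) λ^{β/2}|U|_M)^N = exp(𝒪(1) λ^{β/2}|U|_M). Here the second sum is over sequences of polymers"*); sums over
SETS of distinct polymers need no `1/N!`. [cite: Dimock2013BalabanIII, §3.6 (arXiv:1304.0705v1 TeX L2419–2428)] -/
theorem sum_powerset_prod_le_exp {α : Type*} [DecidableEq α] (s : Finset α) (f : α → ℝ)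
    (hf : ∀ i ∈ s, 0 ≤ f i) : ∑ t ∈ s.powerset, ∏ i ∈ t, f i ≤ exp (∑ i ∈ s, f i) := by
  rw [← Finset.prod_one_add, Real.exp_sum]
  exact Finset.prod_le_prod (fun i hi => by linarith [hf i hi]) fun i hi => by
    linarith [Real.add_one_le_exp (f i)]

omit [NeZero n] in
/-- A sum of non-negative terms over `⋃_{c∈I} Q c` is at most `Σ_{c∈I} Σ_{Q c}`. [folklore] -/
theorem sum_biUnion_le_sum {α ι : Type*} [DecidableEq α] [DecidableEq ι] (I : Finset ι) (Q : ι → Finset α)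
    (a : α → ℝ) (ha : ∀ X, 0 ≤ a X) : ∑ X ∈ I.biUnion Q, a X ≤ ∑ c ∈ I, ∑ X ∈ Q c, a X := by
  refine Finset.induction_on I (by simp) ?_
  intro c I hc ih
  rw [Finset.biUnion_insert, Finset.sum_insert hc]
  exact (sum_union_le_add ha).trans (by linarith)

omit [NeZero n] in
/-- If every member of `P` lies in some `Q c`, `c ∈ I`, a sum of non-negative terms over `P` is at most `Σ_{c∈I} Σ_{Q c}` —
the shape of [Dimock2013BalabanIII] TeX L2430–2435 *"Σ_{Y ⊂ U: …} ≤ Σ_{□ ⊂ U − Θ} Σ_{Y ⊃ □, …}"*. [folklore] -/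
theorem sum_le_sum_sum_of_cover {α ι : Type*} [DecidableEq α] [DecidableEq ι] (P : Finset α) (I : Finset ι)
    (Q : ι → Finset α) (a : α → ℝ) (ha : ∀ X, 0 ≤ a X) (hcov : ∀ X ∈ P, ∃ c ∈ I, X ∈ Q c) :
    ∑ X ∈ P, a X ≤ ∑ c ∈ I, ∑ X ∈ Q c, a X := by
  have h1 : ∑ X ∈ P, a X ≤ ∑ X ∈ I.biUnion Q, a X :=
    Finset.sum_le_sum_of_subset_of_nonneg (fun X hX => by
      obtain ⟨c, hc, hXc⟩ := hcov X hX
      exact Finset.mem_biUnion.2 ⟨c, hc, hXc⟩) (fun X _ _ => ha X)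
  exact h1.trans (sum_biUnion_le_sum I Q a ha)

omit [NeZero n] in
/-- Product bookkeeping: if termwise `full_i ≤ g · e^{−R(ℓ_i + 2)} · red_i` then `Π full ≤ g^{|s|} e^{−R Σ(ℓ_i + 2)} Π
red`. [folklore] -/
theorem prod_le_pow_mul_exp_mul_prod {α : Type*} (s : Finset α) {full red ℓ : α → ℝ} {g R : ℝ}
    (hfull : ∀ i ∈ s, 0 ≤ full i) (h : ∀ i ∈ s, full i ≤ g * exp (-(R * (ℓ i + 2))) * red i) :
    ∏ i ∈ s, full i ≤ g ^ s.card * exp (-(R * ∑ i ∈ s, (ℓ i + 2))) * ∏ i ∈ s, red i := by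
  have hexp : ∏ i ∈ s, exp (-(R * (ℓ i + 2))) = exp (-(R * ∑ i ∈ s, (ℓ i + 2))) := by
    rw [← Real.exp_sum, Finset.mul_sum, ← Finset.sum_neg_distrib]
  calc ∏ i ∈ s, full i ≤ ∏ i ∈ s, (g * exp (-(R * (ℓ i + 2))) * red i) := Finset.prod_le_prod hfull h
    _ = g ^ s.card * exp (-(R * ∑ i ∈ s, (ℓ i + 2))) * ∏ i ∈ s, red i := by
      rw [Finset.prod_mul_distrib, Finset.prod_mul_distrib, Finset.prod_const, hexp]

omit [NeZero n] in
/-- The bookkeeping identity behind *"extract a factor e^{−(κ′−κ₀) d_M(U)}"* and *"pull out an overall factor of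
λ^{β/2}"* (TeX L2402–2404): `[λ^{β/2} e^{2(κ′−κ₀)}] · e^{−(κ′−κ₀)(D+2)} · [λ^{β/2} e^{−κ₀ D}] = λ^β e^{−κ′ D}`. [folklore] -/
theorem weight_identity {lam β κ' κ₀ : ℝ} (hlam : 0 < lam) (D : ℝ) :
    lam ^ (β / 2) * exp (2 * (κ' - κ₀)) * exp (-((κ' - κ₀) * (D + 2))) * (lam ^ (β / 2) * exp (-κ₀ * D))
      = lam ^ β * exp (-(κ' * D)) := by
  have h2 : lam ^ (β / 2) * lam ^ (β / 2) = lam ^ β := by rw [← Real.rpow_add hlam, add_halves]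
  have h3 : exp (2 * (κ' - κ₀)) * exp (-((κ' - κ₀) * (D + 2))) * exp (-κ₀ * D) = exp (-(κ' * D)) := by
    rw [← Real.exp_add, ← Real.exp_add]
    congr 1
    ring
  calc _ = (lam ^ (β / 2) * lam ^ (β / 2)) *
      (exp (2 * (κ' - κ₀)) * exp (-((κ' - κ₀) * (D + 2))) * exp (-κ₀ * D)) := by ring
    _ = lam ^ β * exp (-(κ' * D)) := by rw [h2, h3]

/-! ### 4b. The termwise bound: extraction of `e^{−(κ′−κ₀) d_M(U)}` and of `λ^{β/2}` by Lemma 16 -/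

/-- **THE TERMWISE BOUND (under2) → (under3)** — [Dimock2013BalabanIII] TeX L2402–2406, verbatim: *"The previous result
enables us to extract a factor e^{−(κ′−κ₀) d_M(U)} from the sum, Furthermore since at least one of {Θ_γ}, {X_α}, {Y_σ}
must be nonempty, we can pull out an overall factor of λ^{β/2}."* — PROVED for every term with `⋃𝒯 ∪ ⋃𝒳 ∪ ⋃𝒴 = U`: the
summand of (under2) is at most `λ^{β/2} e^{−(κ′−κ₀) d(U)}` times the product of the REDUCED weights `λ^{β/2} e^{−κ₀
d(Θ_γ)}`, `C λ^{β/2} e^{−κ₀ d(X_α)}`, `C λ^{β/2} e^{−κ₀ d(Y_σ, mod Θ)}` of (under3) (TeX L2408–2417).  Bookkeeping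
(explicit here, inside the printed 𝒪(1) there): with `m ≥ 1` members, Lemma 16 gives `Σ d_i ≥ d(U) − 2(m − 1)`; each
member carries `λ^{n₀} ≤ λ^β` or `λ^β` = two half-powers; one half stays with the member, `m − 1` halves absorb the
`e^{2(κ′−κ₀)}` of the gluing constants under the smallness `λ^{β/2} e^{2(κ′−κ₀)} ≤ 1`, and the last half is the
overall `λ^{β/2}` (DIVERGENCE (ii) of the module docstring: in print these `e^{κ′−κ₀}` = 𝒪(1) in Dimock's convention
and sit inside the 𝒪(1) of (under3)). [cite: Dimock2013BalabanIII, §3.6 (under2)–(under3) (arXiv:1304.0705v1 TeX L2399–2417)] -/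
theorem under2Weight_le {U : Finset (TPt 3 n)} (hUne : U.Nonempty) (hU : TFaceConnected U)
    {𝒯 𝒳 𝒴 : Finset (Finset (TPt 3 n))} (h𝒯 : 𝒯 ⊆ polymersIn U) (h𝒳 : 𝒳 ⊆ polymersIn U)
    (h𝒴 : 𝒴 ⊆ modPolymersIn U (𝒯.biUnion id)) (hcov : 𝒯.biUnion id ∪ 𝒳.biUnion id ∪ 𝒴.biUnion id = U)
    {C lam β κ' κ₀ : ℝ} {n₀ : ℕ} (hC : 0 ≤ C) (hlam : 0 < lam) (hlam1 : lam ≤ 1) (hβn₀ : β ≤ n₀)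
    (hκ : κ₀ ≤ κ') (hsmall : lam ^ (β / 2) * exp (2 * (κ' - κ₀)) ≤ 1) :
    under2Weight C lam β κ' n₀ 𝒯 𝒳 𝒴 ≤ lam ^ (β / 2) * exp (-((κ' - κ₀) * torusTreeLen U)) *
      ((∏ T ∈ 𝒯, lam ^ (β / 2) * exp (-κ₀ * torusTreeLen T)) *
        (∏ X ∈ 𝒳, C * lam ^ (β / 2) * exp (-κ₀ * torusTreeLen X)) *
        ∏ Y ∈ 𝒴, C * lam ^ (β / 2) * exp (-κ₀ * torusTreeLenMod Y (𝒯.biUnion id))) := by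
  classical
  -- at least one member (the three families cover the non-empty U)
  have hm : 1 ≤ 𝒯.card + 𝒳.card + 𝒴.card := by
    by_contra h
    push Not at h
    have h0 : 𝒯.card = 0 ∧ 𝒳.card = 0 ∧ 𝒴.card = 0 := by omega
    rw [Finset.card_eq_zero, Finset.card_eq_zero, Finset.card_eq_zero] at h0
    obtain ⟨h1, h2, h3⟩ := h0
    rw [h1, h2, h3] at hcov
    simp only [Finset.biUnion_empty, Finset.union_empty] at hcov
    exact hUne.ne_empty hcov.symm
  -- abbreviations
  set Θ := 𝒯.biUnion id with hΘ
  set g := lam ^ (β / 2) * exp (2 * (κ' - κ₀)) with hg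
  set PT := ∏ T ∈ 𝒯, lam ^ (β / 2) * exp (-κ₀ * torusTreeLen T) with hPT
  set PX := ∏ X ∈ 𝒳, C * lam ^ (β / 2) * exp (-κ₀ * torusTreeLen X) with hPX
  set PY := ∏ Y ∈ 𝒴, C * lam ^ (β / 2) * exp (-κ₀ * torusTreeLenMod Y Θ) with hPY
  set ST := ∑ T ∈ 𝒯, (torusTreeLen T + 2) with hST
  set SX := ∑ X ∈ 𝒳, (torusTreeLen X + 2) with hSX
  set SY := ∑ Y ∈ 𝒴, (torusTreeLenMod Y Θ + 2) with hSY
  have hR0 : 0 ≤ κ' - κ₀ := by linarith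
  have hlb : 0 ≤ lam ^ (β / 2) := (Real.rpow_pos_of_pos hlam _).le
  have hg0 : 0 ≤ g := mul_nonneg hlb (exp_pos _).le
  have hPT0 : 0 ≤ PT := Finset.prod_nonneg fun T _ => mul_nonneg hlb (exp_pos _).le
  have hPX0 : 0 ≤ PX := Finset.prod_nonneg fun X _ => mul_nonneg (mul_nonneg hC hlb) (exp_pos _).le
  have hPY0 : 0 ≤ PY := Finset.prod_nonneg fun Y _ => mul_nonneg (mul_nonneg hC hlb) (exp_pos _).le
  -- members
  have hm𝒯 : ∀ T ∈ 𝒯, T.Nonempty ∧ TFaceConnected T ∧ T ⊆ U := fun T hT => by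
    obtain ⟨⟨h1, h2⟩, h3⟩ := mem_polymersIn.1 (h𝒯 hT)
    exact ⟨h1, h2, h3⟩
  have hm𝒳 : ∀ X ∈ 𝒳, X.Nonempty ∧ TFaceConnected X ∧ X ⊆ U := fun X hX => by
    obtain ⟨⟨h1, h2⟩, h3⟩ := mem_polymersIn.1 (h𝒳 hX)
    exact ⟨h1, h2, h3⟩
  have hm𝒴 : ∀ Y ∈ 𝒴, Y.Nonempty ∧ TFaceConnected Y ∧ Y ⊆ U ∧ ¬ Y ⊆ Θ := fun Y hY => by
    obtain ⟨⟨h1, h2⟩, h3, -, h4, -⟩ := mem_modPolymersIn.1 (h𝒴 hY)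
    exact ⟨h1, h2, h3, h4⟩
  -- LEMMA 16
  have h16 : torusTreeLen U + 2 ≤ ST + SX + SY := lemma16 hUne hU hm𝒯 hm𝒳 hm𝒴 hcov
  -- λ^{n₀} ≤ λ^β
  have hpow : lam ^ n₀ ≤ lam ^ β := by
    rw [← Real.rpow_natCast]
    exact Real.rpow_le_rpow_of_exponent_ge hlam hlam1 hβn₀
  -- the three product bounds
  have hT : ∏ T ∈ 𝒯, lam ^ n₀ * exp (-(κ' * torusTreeLen T))
      ≤ g ^ 𝒯.card * exp (-((κ' - κ₀) * ST)) * PT := by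
    refine prod_le_pow_mul_exp_mul_prod 𝒯 (fun T _ => mul_nonneg (pow_nonneg hlam.le _) (exp_pos _).le)
      fun T _ => ?_
    rw [hg, weight_identity hlam]
    exact mul_le_mul_of_nonneg_right hpow (exp_pos _).le
  have hX : ∏ X ∈ 𝒳, C * lam ^ β * exp (-(κ' * torusTreeLen X))
      ≤ g ^ 𝒳.card * exp (-((κ' - κ₀) * SX)) * PX := by
    refine prod_le_pow_mul_exp_mul_prod 𝒳
      (fun X _ => mul_nonneg (mul_nonneg hC (Real.rpow_pos_of_pos hlam _).le) (exp_pos _).le) fun X _ => ?_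
    have := weight_identity (β := β) (κ' := κ') (κ₀ := κ₀) hlam (torusTreeLen X)
    rw [hg]
    exact le_of_eq (by linear_combination (-C) * this)
  have hY : ∏ Y ∈ 𝒴, C * lam ^ β * exp (-(κ' * torusTreeLenMod Y Θ))
      ≤ g ^ 𝒴.card * exp (-((κ' - κ₀) * SY)) * PY := by
    refine prod_le_pow_mul_exp_mul_prod 𝒴
      (fun Y _ => mul_nonneg (mul_nonneg hC (Real.rpow_pos_of_pos hlam _).le) (exp_pos _).le) fun Y _ => ?_
    have := weight_identity (β := β) (κ' := κ') (κ₀ := κ₀) hlam (torusTreeLenMod Y Θ)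
    rw [hg]
    exact le_of_eq (by linear_combination (-C) * this)
  -- combine the three
  have hprod : under2Weight C lam β κ' n₀ 𝒯 𝒳 𝒴
      ≤ (g ^ 𝒯.card * exp (-((κ' - κ₀) * ST)) * PT) * (g ^ 𝒳.card * exp (-((κ' - κ₀) * SX)) * PX) *
        (g ^ 𝒴.card * exp (-((κ' - κ₀) * SY)) * PY) := by
    unfold under2Weight
    refine mul_le_mul (mul_le_mul hT hX (Finset.prod_nonneg fun X _ =>
        mul_nonneg (mul_nonneg hC (Real.rpow_pos_of_pos hlam _).le) (exp_pos _).le) (by positivity)) hY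
      (Finset.prod_nonneg fun Y _ => mul_nonneg (mul_nonneg hC (Real.rpow_pos_of_pos hlam _).le)
        (exp_pos _).le) (by positivity)
  have hcomb : (g ^ 𝒯.card * exp (-((κ' - κ₀) * ST)) * PT) * (g ^ 𝒳.card * exp (-((κ' - κ₀) * SX)) * PX) *
        (g ^ 𝒴.card * exp (-((κ' - κ₀) * SY)) * PY)
      = g ^ (𝒯.card + 𝒳.card + 𝒴.card) * exp (-((κ' - κ₀) * (ST + SX + SY))) * (PT * PX * PY) := by
    have he : exp (-((κ' - κ₀) * (ST + SX + SY)))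
        = exp (-((κ' - κ₀) * ST)) * exp (-((κ' - κ₀) * SX)) * exp (-((κ' - κ₀) * SY)) := by
      rw [← Real.exp_add, ← Real.exp_add]
      congr 1
      ring
    rw [he, pow_add, pow_add]
    ring
  -- use Lemma 16 in the exponent
  have hexp16 : exp (-((κ' - κ₀) * (ST + SX + SY))) ≤ exp (-((κ' - κ₀) * (torusTreeLen U + 2))) := by
    rw [Real.exp_le_exp]
    nlinarith
  -- g^m e^{-R(d+2)} ≤ λ^{β/2} e^{-R d}
  have hkey : g ^ (𝒯.card + 𝒳.card + 𝒴.card) * exp (-((κ' - κ₀) * (torusTreeLen U + 2)))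
      ≤ lam ^ (β / 2) * exp (-((κ' - κ₀) * torusTreeLen U)) := by
    obtain ⟨k, hk⟩ : ∃ k, 𝒯.card + 𝒳.card + 𝒴.card = k + 1 := ⟨_, (Nat.sub_add_cancel hm).symm⟩
    rw [hk, pow_succ]
    have hgk : g ^ k ≤ 1 := pow_le_one₀ hg0 hsmall
    have heq : g * exp (-((κ' - κ₀) * (torusTreeLen U + 2))) = lam ^ (β / 2) * exp (-((κ' - κ₀) * torusTreeLen U)) := by
      rw [hg, mul_assoc, ← Real.exp_add]
      congr 2
      ring
    calc g ^ k * g * exp (-((κ' - κ₀) * (torusTreeLen U + 2)))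
        = g ^ k * (g * exp (-((κ' - κ₀) * (torusTreeLen U + 2)))) := by ring
      _ ≤ 1 * (g * exp (-((κ' - κ₀) * (torusTreeLen U + 2)))) :=
          mul_le_mul_of_nonneg_right hgk (mul_nonneg hg0 (exp_pos _).le)
      _ = _ := by rw [one_mul, heq]
  calc under2Weight C lam β κ' n₀ 𝒯 𝒳 𝒴
      ≤ g ^ (𝒯.card + 𝒳.card + 𝒴.card) * exp (-((κ' - κ₀) * (ST + SX + SY))) * (PT * PX * PY) := by
        rw [← hcomb]; exact hprod
    _ ≤ g ^ (𝒯.card + 𝒳.card + 𝒴.card) * exp (-((κ' - κ₀) * (torusTreeLen U + 2))) * (PT * PX * PY) :=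
        mul_le_mul_of_nonneg_right (mul_le_mul_of_nonneg_left hexp16 (pow_nonneg hg0 _)) (by positivity)
    _ ≤ lam ^ (β / 2) * exp (-((κ' - κ₀) * torusTreeLen U)) * (PT * PX * PY) :=
        mul_le_mul_of_nonneg_right hkey (by positivity)

/-! ### 4c. The three free resummations -/

/-- [Dimock2013BalabanIII] TeX L2419, verbatim: *"Using Σ_{X ⊂ U} exp(−κ₀ d_M(X)) ≤ 𝒪(1)|U|_M"* — PROVED from (summing0)
(`Summing0`, discharged on the torus by `summing0_of_kappa₀_le`): `Σ_{X polymer ⊆ U} e^{−κ₀ d(X)} ≤ K |U|`. [cite: Dimock2013BalabanIII, §3.6 (arXiv:1304.0705v1 TeX L2419)] -/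
theorem sum_polymersIn_exp_le {U : Finset (TPt 3 n)} {κ₀ K : ℝ} (hS : Summing0 n κ₀ K) :
    ∑ X ∈ polymersIn U, exp (-κ₀ * torusTreeLen X) ≤ K * U.card := by
  classical
  calc ∑ X ∈ polymersIn U, exp (-κ₀ * torusTreeLen X)
      ≤ ∑ c ∈ U, ∑ X ∈ polymersAt n c, exp (-κ₀ * torusTreeLen X) := by
        refine sum_le_sum_sum_of_cover (polymersIn U) U (polymersAt n) _ (fun _ => (exp_pos _).le) ?_
        intro X hX
        obtain ⟨⟨⟨c, hc⟩, hconn⟩, hXU⟩ := mem_polymersIn.1 hX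
        exact ⟨c, hXU hc, mem_polymersAt.2 ⟨hc, hconn⟩⟩
    _ ≤ ∑ _c ∈ U, K := Finset.sum_le_sum fun c _ => hS c
    _ = K * U.card := by rw [Finset.sum_const, nsmul_eq_mul, mul_comm]

/-- [Dimock2013BalabanIII] TeX L2429–2436, verbatim: *"The sum over {Y_σ} is estimated similarly now using  Σ_{Y ⊂ U: Y #
Θ, Y ∈ 𝒟_𝖭(mod Θ)} e^{−κ₀ d_M(Y, mod Θ)} ≤ Σ_{□ ⊂ U − Θ} Σ_{Y ⊃ □, Y ∈ 𝒟_𝖭(mod Θ)} e^{−κ₀ d_M(Y, mod Θ)} ≤ 𝒪(1)|U −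
Θ|_M ≤ 𝒪(1)|U|_M"* — PROVED from the (snow) shape: every `Y ∈ modPolymersIn U Θ` contains a cube of `U ∖ Θ`. [cite: Dimock2013BalabanIII, §3.6 (arXiv:1304.0705v1 TeX L2429–2436)] -/
theorem sum_modPolymersIn_exp_le {U Θ : Finset (TPt 3 n)} {κ₀ K : ℝ} (hS : SummingMod n κ₀ K) (hK : 0 ≤ K) :
    ∑ Y ∈ modPolymersIn U Θ, exp (-κ₀ * torusTreeLenMod Y Θ) ≤ K * U.card := by
  classical
  calc ∑ Y ∈ modPolymersIn U Θ, exp (-κ₀ * torusTreeLenMod Y Θ)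
      ≤ ∑ c ∈ U \ Θ, ∑ Y ∈ modPolymersAt Θ c, exp (-κ₀ * torusTreeLenMod Y Θ) := by
        refine sum_le_sum_sum_of_cover (modPolymersIn U Θ) (U \ Θ) (modPolymersAt Θ) _
          (fun _ => (exp_pos _).le) ?_
        intro Y hY
        obtain ⟨⟨hne, hconn⟩, hYU, -, hnot, hD⟩ := mem_modPolymersIn.1 hY
        obtain ⟨c, hcY, hcΘ⟩ := Finset.not_subset.1 hnot
        exact ⟨c, Finset.mem_sdiff.2 ⟨hYU hcY, hcΘ⟩, mem_modPolymersAt.2 ⟨⟨hne, hconn⟩, hcY, hD⟩⟩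
    _ ≤ ∑ _c ∈ U \ Θ, K := Finset.sum_le_sum fun c hc => hS Θ c (Finset.mem_sdiff.1 hc).2
    _ = K * (U \ Θ).card := by rw [Finset.sum_const, nsmul_eq_mul, mul_comm]
    _ ≤ K * U.card := by
        refine mul_le_mul_of_nonneg_left ?_ hK
        exact_mod_cast Finset.card_le_card Finset.sdiff_subset

/-! ### 4d. (under2) ⇒ (toot), and the composite with Part 6 of `…Phi43PolymerRepresentation` -/

/-- **(under2) ⇒ (toot), PROVED** — [Dimock2013BalabanIII] §3.6 from (under2) to (toot) (TeX L2399–2441): extraction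
by Lemma 16 (`under2Weight_le`), then the three free resummations, verbatim (TeX L2437–2441): *"Finally the sum over
{Θ_γ} is estimated just as the sum over {X_α}. Thus we have  |𝒦(U)| ≤ λ^{β/2} exp(−(κ′−κ₀) d_M(U) + 𝒪(1) λ^{β/2}
|U|_M)"* — over the cell's torus polymer model: from the (under2) shape at rate `κ′` with constant `C` and integer `n₀ ≥
β`, the (snow) shape `SummingMod n κ₀ K₁` and (summing0) DISCHARGED for `κ₀ ≥ κ₀(32, 6)` (unit pv22), under `0 < λ ≤ 1`,
`κ₀ ≤ κ′` and the displayed smallness `λ^{β/2} e^{2(κ′−κ₀)} ≤ 1`, the (toot) shape `TootBound` of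
`…Phi43PolymerRepresentation` Part 6 holds with rate `κ′ − κ₀` (= `R + 1`, `R := κ′ − κ₀ − 1`) and EXPLICIT `𝒪(1) =
K₀(32,6) + C·K₀(32,6) + C·K₁` (the Θ-, X- and Y-resummations respectively).  Order of summation as printed: the
`Y`-sum (which depends on `Θ = ⋃𝒯`) innermost, bounded uniformly in `Θ`. [cite: Dimock2013BalabanIII, §3.6 (under2)–(toot) (arXiv:1304.0705v1 TeX L2399–2441)] -/
theorem tootBound_of_under2 {K : TDom 3 n → ℝ} {C lam β κ' κ₀ K₁ : ℝ} {n₀ : ℕ}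
    (hK : Under2Bound n K C lam β κ' n₀) (hmod : SummingMod n κ₀ K₁) (hκ₀ : kappa₀ 32 6 ≤ κ₀)
    (hκ : κ₀ ≤ κ') (hC : 0 ≤ C) (hK₁ : 0 ≤ K₁) (hlam : 0 < lam) (hlam1 : lam ≤ 1) (hβn₀ : β ≤ n₀)
    (hsmall : lam ^ (β / 2) * exp (2 * (κ' - κ₀)) ≤ 1) :
    TootBound n K (K₀ 32 6 + C * K₀ 32 6 + C * K₁) lam β (κ' - κ₀ - 1) := by
  classical
  intro U
  have hS0 : Summing0 n κ₀ (K₀ 32 6) := summing0_of_kappa₀_le n hκ₀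
  have hK₀ : 0 ≤ K₀ 32 6 := (K₀_pos 32 6).le
  have hlb : 0 ≤ lam ^ (β / 2) := (Real.rpow_pos_of_pos hlam _).le
  set P := polymersIn U.1 with hP
  set A := lam ^ (β / 2) * exp (-((κ' - κ₀) * torusTreeLen U.1)) with hA
  set aT : Finset (TPt 3 n) → ℝ := fun T => lam ^ (β / 2) * exp (-κ₀ * torusTreeLen T) with haT
  set aX : Finset (TPt 3 n) → ℝ := fun X => C * lam ^ (β / 2) * exp (-κ₀ * torusTreeLen X) with haX
  set aY : Finset (TPt 3 n) → Finset (TPt 3 n) → ℝ :=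
    fun Θ Y => C * lam ^ (β / 2) * exp (-κ₀ * torusTreeLenMod Y Θ) with haY
  set ET := exp (K₀ 32 6 * lam ^ (β / 2) * U.1.card) with hET
  set EX := exp (C * K₀ 32 6 * lam ^ (β / 2) * U.1.card) with hEX
  set EY := exp (C * K₁ * lam ^ (β / 2) * U.1.card) with hEY
  have hA0 : 0 ≤ A := mul_nonneg hlb (exp_pos _).le
  have haT0 : ∀ T, 0 ≤ aT T := fun T => mul_nonneg hlb (exp_pos _).le
  have haX0 : ∀ X, 0 ≤ aX X := fun X => mul_nonneg (mul_nonneg hC hlb) (exp_pos _).le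
  have haY0 : ∀ Θ Y, 0 ≤ aY Θ Y := fun Θ Y => mul_nonneg (mul_nonneg hC hlb) (exp_pos _).le
  -- the three free resummations
  have hT : ∑ 𝒯 ∈ P.powerset, ∏ T ∈ 𝒯, aT T ≤ ET := by
    refine (sum_powerset_prod_le_exp P aT fun T _ => haT0 T).trans ?_
    rw [hET, Real.exp_le_exp]
    have h := sum_polymersIn_exp_le (U := U.1) hS0
    calc ∑ T ∈ P, aT T = lam ^ (β / 2) * ∑ T ∈ P, exp (-κ₀ * torusTreeLen T) := by
          rw [haT, Finset.mul_sum]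
      _ ≤ lam ^ (β / 2) * (K₀ 32 6 * U.1.card) := mul_le_mul_of_nonneg_left h hlb
      _ = _ := by ring
  have hX : ∑ 𝒳 ∈ P.powerset, ∏ X ∈ 𝒳, aX X ≤ EX := by
    refine (sum_powerset_prod_le_exp P aX fun X _ => haX0 X).trans ?_
    rw [hEX, Real.exp_le_exp]
    have h := sum_polymersIn_exp_le (U := U.1) hS0
    calc ∑ X ∈ P, aX X = C * lam ^ (β / 2) * ∑ X ∈ P, exp (-κ₀ * torusTreeLen X) := by
          rw [haX, Finset.mul_sum]
      _ ≤ C * lam ^ (β / 2) * (K₀ 32 6 * U.1.card) := mul_le_mul_of_nonneg_left h (mul_nonneg hC hlb)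
      _ = _ := by ring
  have hY : ∀ Θ : Finset (TPt 3 n), ∑ 𝒴 ∈ (modPolymersIn U.1 Θ).powerset, ∏ Y ∈ 𝒴, aY Θ Y ≤ EY := by
    intro Θ
    refine (sum_powerset_prod_le_exp _ (aY Θ) fun Y _ => haY0 Θ Y).trans ?_
    rw [hEY, Real.exp_le_exp]
    have h := sum_modPolymersIn_exp_le (U := U.1) (Θ := Θ) hmod hK₁
    calc ∑ Y ∈ modPolymersIn U.1 Θ, aY Θ Y
        = C * lam ^ (β / 2) * ∑ Y ∈ modPolymersIn U.1 Θ, exp (-κ₀ * torusTreeLenMod Y Θ) := by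
          rw [haY, Finset.mul_sum]
      _ ≤ C * lam ^ (β / 2) * (K₁ * U.1.card) := mul_le_mul_of_nonneg_left h (mul_nonneg hC hlb)
      _ = _ := by ring
  -- termwise bound
  have h2 : ∀ 𝒯 ∈ P.powerset, ∀ 𝒳 ∈ P.powerset, ∀ 𝒴 ∈ (modPolymersIn U.1 (𝒯.biUnion id)).powerset,
      (if 𝒯.biUnion id ∪ 𝒳.biUnion id ∪ 𝒴.biUnion id = U.1 then under2Weight C lam β κ' n₀ 𝒯 𝒳 𝒴
        else 0) ≤ A * ((∏ T ∈ 𝒯, aT T) * (∏ X ∈ 𝒳, aX X) * ∏ Y ∈ 𝒴, aY (𝒯.biUnion id) Y) := by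
    intro 𝒯 h𝒯 𝒳 h𝒳 𝒴 h𝒴
    split_ifs with hcov
    · exact under2Weight_le U.2.1 U.2.2 (Finset.mem_powerset.1 h𝒯) (Finset.mem_powerset.1 h𝒳)
        (Finset.mem_powerset.1 h𝒴) hcov hC hlam hlam1 hβn₀ hκ hsmall
    · exact mul_nonneg hA0 (mul_nonneg (mul_nonneg (Finset.prod_nonneg fun T _ => haT0 T)
        (Finset.prod_nonneg fun X _ => haX0 X)) (Finset.prod_nonneg fun Y _ => haY0 _ Y))
  -- inner sums
  have h3 : ∀ 𝒯 ∈ P.powerset, ∀ 𝒳 ∈ P.powerset,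
      ∑ 𝒴 ∈ (modPolymersIn U.1 (𝒯.biUnion id)).powerset,
        (if 𝒯.biUnion id ∪ 𝒳.biUnion id ∪ 𝒴.biUnion id = U.1 then under2Weight C lam β κ' n₀ 𝒯 𝒳 𝒴
          else 0) ≤ A * (∏ T ∈ 𝒯, aT T) * (∏ X ∈ 𝒳, aX X) * EY := by
    intro 𝒯 h𝒯 𝒳 h𝒳
    calc _ ≤ ∑ 𝒴 ∈ (modPolymersIn U.1 (𝒯.biUnion id)).powerset,
          A * ((∏ T ∈ 𝒯, aT T) * (∏ X ∈ 𝒳, aX X) * ∏ Y ∈ 𝒴, aY (𝒯.biUnion id) Y) :=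
          Finset.sum_le_sum fun 𝒴 h𝒴 => h2 𝒯 h𝒯 𝒳 h𝒳 𝒴 h𝒴
      _ = A * (∏ T ∈ 𝒯, aT T) * (∏ X ∈ 𝒳, aX X) *
          ∑ 𝒴 ∈ (modPolymersIn U.1 (𝒯.biUnion id)).powerset, ∏ Y ∈ 𝒴, aY (𝒯.biUnion id) Y := by
          rw [Finset.mul_sum]
          refine Finset.sum_congr rfl fun 𝒴 _ => by ring
      _ ≤ A * (∏ T ∈ 𝒯, aT T) * (∏ X ∈ 𝒳, aX X) * EY :=
          mul_le_mul_of_nonneg_left (hY _) (mul_nonneg (mul_nonneg hA0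
            (Finset.prod_nonneg fun T _ => haT0 T)) (Finset.prod_nonneg fun X _ => haX0 X))
  have h4 : ∀ 𝒯 ∈ P.powerset,
      ∑ 𝒳 ∈ P.powerset, ∑ 𝒴 ∈ (modPolymersIn U.1 (𝒯.biUnion id)).powerset,
        (if 𝒯.biUnion id ∪ 𝒳.biUnion id ∪ 𝒴.biUnion id = U.1 then under2Weight C lam β κ' n₀ 𝒯 𝒳 𝒴
          else 0) ≤ A * (∏ T ∈ 𝒯, aT T) * EX * EY := by
    intro 𝒯 h𝒯
    calc _ ≤ ∑ 𝒳 ∈ P.powerset, A * (∏ T ∈ 𝒯, aT T) * (∏ X ∈ 𝒳, aX X) * EY :=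
          Finset.sum_le_sum fun 𝒳 h𝒳 => h3 𝒯 h𝒯 𝒳 h𝒳
      _ = A * (∏ T ∈ 𝒯, aT T) * EY * ∑ 𝒳 ∈ P.powerset, ∏ X ∈ 𝒳, aX X := by
          rw [Finset.mul_sum]
          refine Finset.sum_congr rfl fun 𝒳 _ => by ring
      _ ≤ A * (∏ T ∈ 𝒯, aT T) * EY * EX :=
          mul_le_mul_of_nonneg_left hX (mul_nonneg (mul_nonneg hA0
            (Finset.prod_nonneg fun T _ => haT0 T)) (exp_pos _).le)
      _ = _ := by ring
  have h5 : |K U| ≤ A * ET * EX * EY := by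
    calc |K U| ≤ _ := hK U
      _ ≤ ∑ 𝒯 ∈ P.powerset, A * (∏ T ∈ 𝒯, aT T) * EX * EY := Finset.sum_le_sum fun 𝒯 h𝒯 => h4 𝒯 h𝒯
      _ = A * EX * EY * ∑ 𝒯 ∈ P.powerset, ∏ T ∈ 𝒯, aT T := by
          rw [Finset.mul_sum]
          refine Finset.sum_congr rfl fun 𝒯 _ => by ring
      _ ≤ A * EX * EY * ET :=
          mul_le_mul_of_nonneg_left hT (mul_nonneg (mul_nonneg hA0 (exp_pos _).le) (exp_pos _).le)
      _ = _ := by ring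
  -- assemble the printed form of (toot)
  have hfin : A * ET * EX * EY = lam ^ (β / 2) *
      exp (-((κ' - κ₀ - 1 + 1) * torusTreeLen U.1) +
        (K₀ 32 6 + C * K₀ 32 6 + C * K₁) * lam ^ (β / 2) * (U.1.card : ℝ)) := by
    rw [hA, hET, hEX, hEY, mul_assoc, mul_assoc, mul_assoc, ← Real.exp_add, ← Real.exp_add, ← Real.exp_add]
    congr 2
    ring
  rw [← hfin]
  exact h5

/-- **(stingray) ∧ (under2) ∧ (snow) ⇒ COROLLARY 1, assembled**: the whole of [Dimock2013BalabanIII] §3.6 — (under2)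
⇒ [Lemma 16] (under3) ⇒ (toot) ⇒ Lemma 17 (swat) ⇒ [with (stingray), Kotecký–Preiss] Theorem 2 (soso) ∧ (such) ⇒
Corollary 1 — is KERNEL-CHECKED over the cell's torus polymer model, by composing `tootBound_of_under2` with this
lineage's `stability_of_toot` (`…Phi43PolymerRepresentation` Part 6, p182742).  Hypotheses: the shapes (stingray)
(`ComponentRepresentation`), (under2) (`Under2Bound`), (snow) (`SummingMod`); `κ₀(32,6) ≤ κ₀ ≤ κ′`; `0 < λ ≤ 1`, `β ≤
n₀`; the smallness conditions displayed (`λ^{β/2} e^{2(κ′−κ₀)} ≤ 1`; `32·c·λ^{β/2} ≤ 1` with `c = K₀ + C K₀ + C K₁`; the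
Kotecký–Preiss smallness; the rate window `r₁ + 2κ₀(32,6) + 2 ≤ κ′ − κ₀ − 1`, `r₁ ≥ κ₀(32,6)`) and the absorbed `M³`
condition of Corollary 1; `m ≤ 𝖬`.  What is NOT kernel on the template side after this: §3.1–3.4 ((stingray) and (under)
themselves), §3.5 (Lemma 14 (ugh2), Lemma 15 (sushi): the history sum giving 𝒦′(Θ) ≤ Π_γ λ^{n₀} e^{−κ′|Θ_γ|_M}), the (snow)
shape on the torus, and Theorem 1. [cite: Dimock2013BalabanIII, §3.6 (arXiv:1304.0705v1 TeX L2346–2505)] -/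
theorem stability_of_under2 {L m Mv N : ℕ} [NeZero L] [NeZero (L ^ (Mv - m))] {lam ε₀ μ₀ : ℝ}
    {K : TDom 3 (L ^ (Mv - m)) → ℝ} {C β κ' κ₀ K₁ r₁ : ℝ} {n₀ : ℕ} (hm : m ≤ Mv)
    (hrep : ComponentRepresentation L Mv N (L ^ (Mv - m)) lam ε₀ μ₀ K)
    (hK : Under2Bound (L ^ (Mv - m)) K C lam β κ' n₀) (hmod : SummingMod (L ^ (Mv - m)) κ₀ K₁)
    (hκ₀ : kappa₀ 32 6 ≤ κ₀) (hκ : κ₀ ≤ κ') (hC : 0 ≤ C) (hK₁ : 0 ≤ K₁) (hlam : 0 < lam)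
    (hlam1 : lam ≤ 1) (hβn₀ : β ≤ n₀) (hsmall : lam ^ (β / 2) * exp (2 * (κ' - κ₀)) ≤ 1)
    (htoot : 32 * (K₀ 32 6 + C * K₀ 32 6 + C * K₁) * lam ^ (β / 2) ≤ 1)
    (hr₁ : kappa₀ 32 6 ≤ r₁) (hrate : r₁ + 2 * kappa₀ 32 6 + 2 ≤ κ' - κ₀ - 1)
    (hKP : exp (1 / 4) * lam ^ (β / 2) * exp (5 * r₁ + 1) * K₀ 32 6 * 32 ≤ 1)
    (hM : exp 1 * 32 * K₀ 32 6 ^ 2 * exp (1 / 4) * K₀ 32 6 ≤ ((L : ℝ) ^ m) ^ 3) :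
    exp (-(lam ^ (β / 2) * (L : ℝ) ^ (3 * Mv))) ≤ relativePartitionFunction L Mv N 1 lam ε₀ μ₀ ∧
      relativePartitionFunction L Mv N 1 lam ε₀ μ₀ ≤ exp (lam ^ (β / 2) * (L : ℝ) ^ (3 * Mv)) := by
  have hK₀ : 0 ≤ K₀ 32 6 := (K₀_pos 32 6).le
  exact stability_of_toot hm hrep (tootBound_of_under2 hK hmod hκ₀ hκ hC hK₁ hlam hlam1 hβn₀ hsmall)
    (by positivity) hlam htoot hr₁ hrate hKP hM


/-! ### 4e (v1.1, append-only). The print-faithful form: no smallness, the gluing constants inside 𝒪(1) -/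

/-- **THE TERMWISE BOUND WITH THE PRINTED ABSORPTION** (cross-read advisory C-pv18g10-1 A2): as `under2Weight_le`, but
WITHOUT the smallness `λ^{β/2} e^{2(κ′−κ₀)} ≤ 1` — the factor `e^{2(κ′−κ₀)}` per member is kept inside the reduced
weights, i.e. inside the 𝒪(1) of (under3) exactly as in print ([Dimock2013BalabanIII] TeX L387: *"𝒪(1) stands for a
generic constant independent of all parameters"*; κ′, κ₀ are such constants): the summand of (under2) is at most
`λ^{β/2} e^{−(κ′−κ₀) d(U)}` times the product of `e^{2(κ′−κ₀)} λ^{β/2} e^{−κ₀ d(Θ_γ)}`, `C e^{2(κ′−κ₀)} λ^{β/2} e^{−κ₀ d(X_α)}`,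
`C e^{2(κ′−κ₀)} λ^{β/2} e^{−κ₀ d(Y_σ, mod Θ)}` (the overall `λ^{β/2}` from `(λ^{β/2})^m ≤ λ^{β/2}`, `m ≥ 1`, `λ ≤ 1`).
[cite: Dimock2013BalabanIII, §3.6 (under2)–(under3) (arXiv:1304.0705v1 TeX L2399–2417)] -/
theorem under2Weight_le_print {U : Finset (TPt 3 n)} (hUne : U.Nonempty) (hU : TFaceConnected U)
    {𝒯 𝒳 𝒴 : Finset (Finset (TPt 3 n))} (h𝒯 : 𝒯 ⊆ polymersIn U) (h𝒳 : 𝒳 ⊆ polymersIn U)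
    (h𝒴 : 𝒴 ⊆ modPolymersIn U (𝒯.biUnion id)) (hcov : 𝒯.biUnion id ∪ 𝒳.biUnion id ∪ 𝒴.biUnion id = U)
    {C lam β κ' κ₀ : ℝ} {n₀ : ℕ} (hC : 0 ≤ C) (hlam : 0 < lam) (hlam1 : lam ≤ 1) (hβ : 0 ≤ β) (hβn₀ : β ≤ n₀)
    (hκ : κ₀ ≤ κ') :
    under2Weight C lam β κ' n₀ 𝒯 𝒳 𝒴 ≤ lam ^ (β / 2) * exp (-((κ' - κ₀) * torusTreeLen U)) *
      ((∏ T ∈ 𝒯, exp (2 * (κ' - κ₀)) * lam ^ (β / 2) * exp (-κ₀ * torusTreeLen T)) *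
        (∏ X ∈ 𝒳, C * exp (2 * (κ' - κ₀)) * lam ^ (β / 2) * exp (-κ₀ * torusTreeLen X)) *
        ∏ Y ∈ 𝒴, C * exp (2 * (κ' - κ₀)) * lam ^ (β / 2) * exp (-κ₀ * torusTreeLenMod Y (𝒯.biUnion id))) := by
  classical
  have hm : 1 ≤ 𝒯.card + 𝒳.card + 𝒴.card := by
    by_contra h
    push Not at h
    have h0 : 𝒯.card = 0 ∧ 𝒳.card = 0 ∧ 𝒴.card = 0 := by omega
    rw [Finset.card_eq_zero, Finset.card_eq_zero, Finset.card_eq_zero] at h0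
    obtain ⟨h1, h2, h3⟩ := h0
    rw [h1, h2, h3] at hcov
    simp only [Finset.biUnion_empty, Finset.union_empty] at hcov
    exact hUne.ne_empty hcov.symm
  set Θ := 𝒯.biUnion id with hΘ
  set g := lam ^ (β / 2) with hg
  set E := exp (2 * (κ' - κ₀)) with hE
  set PT := ∏ T ∈ 𝒯, E * lam ^ (β / 2) * exp (-κ₀ * torusTreeLen T) with hPT
  set PX := ∏ X ∈ 𝒳, C * E * lam ^ (β / 2) * exp (-κ₀ * torusTreeLen X) with hPX
  set PY := ∏ Y ∈ 𝒴, C * E * lam ^ (β / 2) * exp (-κ₀ * torusTreeLenMod Y Θ) with hPY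
  set ST := ∑ T ∈ 𝒯, (torusTreeLen T + 2) with hST
  set SX := ∑ X ∈ 𝒳, (torusTreeLen X + 2) with hSX
  set SY := ∑ Y ∈ 𝒴, (torusTreeLenMod Y Θ + 2) with hSY
  have hR0 : 0 ≤ κ' - κ₀ := by linarith
  have hg0 : 0 ≤ g := (Real.rpow_pos_of_pos hlam _).le
  have hg1 : g ≤ 1 := Real.rpow_le_one hlam.le hlam1 (by linarith)
  have hE0 : 0 ≤ E := (exp_pos _).le
  have hPT0 : 0 ≤ PT := Finset.prod_nonneg fun T _ => mul_nonneg (mul_nonneg hE0 hg0) (exp_pos _).le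
  have hPX0 : 0 ≤ PX :=
    Finset.prod_nonneg fun X _ => mul_nonneg (mul_nonneg (mul_nonneg hC hE0) hg0) (exp_pos _).le
  have hPY0 : 0 ≤ PY :=
    Finset.prod_nonneg fun Y _ => mul_nonneg (mul_nonneg (mul_nonneg hC hE0) hg0) (exp_pos _).le
  have hm𝒯 : ∀ T ∈ 𝒯, T.Nonempty ∧ TFaceConnected T ∧ T ⊆ U := fun T hT => by
    obtain ⟨⟨h1, h2⟩, h3⟩ := mem_polymersIn.1 (h𝒯 hT)
    exact ⟨h1, h2, h3⟩
  have hm𝒳 : ∀ X ∈ 𝒳, X.Nonempty ∧ TFaceConnected X ∧ X ⊆ U := fun X hX => by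
    obtain ⟨⟨h1, h2⟩, h3⟩ := mem_polymersIn.1 (h𝒳 hX)
    exact ⟨h1, h2, h3⟩
  have hm𝒴 : ∀ Y ∈ 𝒴, Y.Nonempty ∧ TFaceConnected Y ∧ Y ⊆ U ∧ ¬ Y ⊆ Θ := fun Y hY => by
    obtain ⟨⟨h1, h2⟩, h3, -, h4, -⟩ := mem_modPolymersIn.1 (h𝒴 hY)
    exact ⟨h1, h2, h3, h4⟩
  have h16 : torusTreeLen U + 2 ≤ ST + SX + SY := lemma16 hUne hU hm𝒯 hm𝒳 hm𝒴 hcov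
  have hpow : lam ^ n₀ ≤ lam ^ β := by
    rw [← Real.rpow_natCast]
    exact Real.rpow_le_rpow_of_exponent_ge hlam hlam1 hβn₀
  -- the identity g · e^{−R(D+2)} · (E g e^{−κ₀ D}) = λ^β e^{−κ′ D}
  have hid : ∀ D : ℝ, g * exp (-((κ' - κ₀) * (D + 2))) * (E * lam ^ (β / 2) * exp (-κ₀ * D))
      = lam ^ β * exp (-(κ' * D)) := by
    intro D
    rw [hg, hE, ← weight_identity (β := β) (κ' := κ') (κ₀ := κ₀) hlam D]
    ring
  have hT : ∏ T ∈ 𝒯, lam ^ n₀ * exp (-(κ' * torusTreeLen T))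
      ≤ g ^ 𝒯.card * exp (-((κ' - κ₀) * ST)) * PT := by
    refine prod_le_pow_mul_exp_mul_prod 𝒯 (fun T _ => mul_nonneg (pow_nonneg hlam.le _) (exp_pos _).le)
      fun T _ => ?_
    rw [hid]
    exact mul_le_mul_of_nonneg_right hpow (exp_pos _).le
  have hX : ∏ X ∈ 𝒳, C * lam ^ β * exp (-(κ' * torusTreeLen X))
      ≤ g ^ 𝒳.card * exp (-((κ' - κ₀) * SX)) * PX := by
    refine prod_le_pow_mul_exp_mul_prod 𝒳
      (fun X _ => mul_nonneg (mul_nonneg hC (Real.rpow_pos_of_pos hlam _).le) (exp_pos _).le) fun X _ => ?_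
    have := hid (torusTreeLen X)
    exact le_of_eq (by linear_combination (-C) * this)
  have hY : ∏ Y ∈ 𝒴, C * lam ^ β * exp (-(κ' * torusTreeLenMod Y Θ))
      ≤ g ^ 𝒴.card * exp (-((κ' - κ₀) * SY)) * PY := by
    refine prod_le_pow_mul_exp_mul_prod 𝒴
      (fun Y _ => mul_nonneg (mul_nonneg hC (Real.rpow_pos_of_pos hlam _).le) (exp_pos _).le) fun Y _ => ?_
    have := hid (torusTreeLenMod Y Θ)
    exact le_of_eq (by linear_combination (-C) * this)
  have hprod : under2Weight C lam β κ' n₀ 𝒯 𝒳 𝒴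
      ≤ (g ^ 𝒯.card * exp (-((κ' - κ₀) * ST)) * PT) * (g ^ 𝒳.card * exp (-((κ' - κ₀) * SX)) * PX) *
        (g ^ 𝒴.card * exp (-((κ' - κ₀) * SY)) * PY) := by
    unfold under2Weight
    refine mul_le_mul (mul_le_mul hT hX (Finset.prod_nonneg fun X _ =>
        mul_nonneg (mul_nonneg hC (Real.rpow_pos_of_pos hlam _).le) (exp_pos _).le) (by positivity)) hY
      (Finset.prod_nonneg fun Y _ => mul_nonneg (mul_nonneg hC (Real.rpow_pos_of_pos hlam _).le)
        (exp_pos _).le) (by positivity)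
  have hcomb : (g ^ 𝒯.card * exp (-((κ' - κ₀) * ST)) * PT) * (g ^ 𝒳.card * exp (-((κ' - κ₀) * SX)) * PX) *
        (g ^ 𝒴.card * exp (-((κ' - κ₀) * SY)) * PY)
      = g ^ (𝒯.card + 𝒳.card + 𝒴.card) * exp (-((κ' - κ₀) * (ST + SX + SY))) * (PT * PX * PY) := by
    have he : exp (-((κ' - κ₀) * (ST + SX + SY)))
        = exp (-((κ' - κ₀) * ST)) * exp (-((κ' - κ₀) * SX)) * exp (-((κ' - κ₀) * SY)) := by
      rw [← Real.exp_add, ← Real.exp_add]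
      congr 1
      ring
    rw [he, pow_add, pow_add]
    ring
  have hexp16 : exp (-((κ' - κ₀) * (ST + SX + SY))) ≤ exp (-((κ' - κ₀) * torusTreeLen U)) := by
    rw [Real.exp_le_exp]
    nlinarith
  have hkey : g ^ (𝒯.card + 𝒳.card + 𝒴.card) ≤ lam ^ (β / 2) := by
    obtain ⟨k, hk⟩ : ∃ k, 𝒯.card + 𝒳.card + 𝒴.card = k + 1 := ⟨_, (Nat.sub_add_cancel hm).symm⟩
    rw [hk, pow_succ, hg]
    have : (lam ^ (β / 2)) ^ k ≤ 1 := pow_le_one₀ hg0 hg1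
    calc (lam ^ (β / 2)) ^ k * lam ^ (β / 2) ≤ 1 * lam ^ (β / 2) := mul_le_mul_of_nonneg_right this hg0
      _ = lam ^ (β / 2) := one_mul _
  calc under2Weight C lam β κ' n₀ 𝒯 𝒳 𝒴
      ≤ g ^ (𝒯.card + 𝒳.card + 𝒴.card) * exp (-((κ' - κ₀) * (ST + SX + SY))) * (PT * PX * PY) := by
        rw [← hcomb]; exact hprod
    _ ≤ lam ^ (β / 2) * exp (-((κ' - κ₀) * torusTreeLen U)) * (PT * PX * PY) :=
        mul_le_mul_of_nonneg_right (mul_le_mul hkey hexp16 (exp_pos _).le (Real.rpow_pos_of_pos hlam _).le)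
          (by positivity)

/-- **(under2) ⇒ (toot) WITH THE PRINTED CONSTANTS** (cross-read advisory C-pv18g10-1 A2): as `tootBound_of_under2` but
WITHOUT the smallness hypothesis `λ^{β/2} e^{2(κ′−κ₀)} ≤ 1`; the gluing constants are absorbed into the 𝒪(1) of (toot) as in
print: `𝒪(1) = e^{2(κ′−κ₀)} (K₀(32,6) + C·K₀(32,6) + C·K₁)`. [cite: Dimock2013BalabanIII, §3.6 (under2)–(toot) (arXiv:1304.0705v1 TeX L2399–2441)] -/
theorem tootBound_of_under2_print {K : TDom 3 n → ℝ} {C lam β κ' κ₀ K₁ : ℝ} {n₀ : ℕ}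
    (hK : Under2Bound n K C lam β κ' n₀) (hmod : SummingMod n κ₀ K₁) (hκ₀ : kappa₀ 32 6 ≤ κ₀)
    (hκ : κ₀ ≤ κ') (hC : 0 ≤ C) (hK₁ : 0 ≤ K₁) (hlam : 0 < lam) (hlam1 : lam ≤ 1) (hβ : 0 ≤ β) (hβn₀ : β ≤ n₀) :
    TootBound n K (exp (2 * (κ' - κ₀)) * (K₀ 32 6 + C * K₀ 32 6 + C * K₁)) lam β (κ' - κ₀ - 1) := by
  classical
  intro U
  have hS0 : Summing0 n κ₀ (K₀ 32 6) := summing0_of_kappa₀_le n hκ₀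
  have hK₀ : 0 ≤ K₀ 32 6 := (K₀_pos 32 6).le
  have hlb : 0 ≤ lam ^ (β / 2) := (Real.rpow_pos_of_pos hlam _).le
  set E := exp (2 * (κ' - κ₀)) with hE
  have hE0 : 0 ≤ E := (exp_pos _).le
  set P := polymersIn U.1 with hP
  set A := lam ^ (β / 2) * exp (-((κ' - κ₀) * torusTreeLen U.1)) with hA
  set aT : Finset (TPt 3 n) → ℝ := fun T => E * lam ^ (β / 2) * exp (-κ₀ * torusTreeLen T) with haT
  set aX : Finset (TPt 3 n) → ℝ := fun X => C * E * lam ^ (β / 2) * exp (-κ₀ * torusTreeLen X) with haX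
  set aY : Finset (TPt 3 n) → Finset (TPt 3 n) → ℝ :=
    fun Θ Y => C * E * lam ^ (β / 2) * exp (-κ₀ * torusTreeLenMod Y Θ) with haY
  set ET := exp (E * K₀ 32 6 * lam ^ (β / 2) * U.1.card) with hET
  set EX := exp (E * C * K₀ 32 6 * lam ^ (β / 2) * U.1.card) with hEX
  set EY := exp (E * C * K₁ * lam ^ (β / 2) * U.1.card) with hEY
  have hA0 : 0 ≤ A := mul_nonneg hlb (exp_pos _).le
  have haT0 : ∀ T, 0 ≤ aT T := fun T => mul_nonneg (mul_nonneg hE0 hlb) (exp_pos _).le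
  have haX0 : ∀ X, 0 ≤ aX X := fun X => mul_nonneg (mul_nonneg (mul_nonneg hC hE0) hlb) (exp_pos _).le
  have haY0 : ∀ Θ Y, 0 ≤ aY Θ Y := fun Θ Y => mul_nonneg (mul_nonneg (mul_nonneg hC hE0) hlb) (exp_pos _).le
  have hT : ∑ 𝒯 ∈ P.powerset, ∏ T ∈ 𝒯, aT T ≤ ET := by
    refine (sum_powerset_prod_le_exp P aT fun T _ => haT0 T).trans ?_
    rw [hET, Real.exp_le_exp]
    have h := sum_polymersIn_exp_le (U := U.1) hS0
    calc ∑ T ∈ P, aT T = E * lam ^ (β / 2) * ∑ T ∈ P, exp (-κ₀ * torusTreeLen T) := by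
          rw [haT, Finset.mul_sum]
      _ ≤ E * lam ^ (β / 2) * (K₀ 32 6 * U.1.card) := mul_le_mul_of_nonneg_left h (mul_nonneg hE0 hlb)
      _ = _ := by ring
  have hX : ∑ 𝒳 ∈ P.powerset, ∏ X ∈ 𝒳, aX X ≤ EX := by
    refine (sum_powerset_prod_le_exp P aX fun X _ => haX0 X).trans ?_
    rw [hEX, Real.exp_le_exp]
    have h := sum_polymersIn_exp_le (U := U.1) hS0
    calc ∑ X ∈ P, aX X = C * E * lam ^ (β / 2) * ∑ X ∈ P, exp (-κ₀ * torusTreeLen X) := by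
          rw [haX, Finset.mul_sum]
      _ ≤ C * E * lam ^ (β / 2) * (K₀ 32 6 * U.1.card) :=
          mul_le_mul_of_nonneg_left h (mul_nonneg (mul_nonneg hC hE0) hlb)
      _ = _ := by ring
  have hY : ∀ Θ : Finset (TPt 3 n), ∑ 𝒴 ∈ (modPolymersIn U.1 Θ).powerset, ∏ Y ∈ 𝒴, aY Θ Y ≤ EY := by
    intro Θ
    refine (sum_powerset_prod_le_exp _ (aY Θ) fun Y _ => haY0 Θ Y).trans ?_
    rw [hEY, Real.exp_le_exp]
    have h := sum_modPolymersIn_exp_le (U := U.1) (Θ := Θ) hmod hK₁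
    calc ∑ Y ∈ modPolymersIn U.1 Θ, aY Θ Y
        = C * E * lam ^ (β / 2) * ∑ Y ∈ modPolymersIn U.1 Θ, exp (-κ₀ * torusTreeLenMod Y Θ) := by
          rw [haY, Finset.mul_sum]
      _ ≤ C * E * lam ^ (β / 2) * (K₁ * U.1.card) :=
          mul_le_mul_of_nonneg_left h (mul_nonneg (mul_nonneg hC hE0) hlb)
      _ = _ := by ring
  have h2 : ∀ 𝒯 ∈ P.powerset, ∀ 𝒳 ∈ P.powerset, ∀ 𝒴 ∈ (modPolymersIn U.1 (𝒯.biUnion id)).powerset,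
      (if 𝒯.biUnion id ∪ 𝒳.biUnion id ∪ 𝒴.biUnion id = U.1 then under2Weight C lam β κ' n₀ 𝒯 𝒳 𝒴
        else 0) ≤ A * ((∏ T ∈ 𝒯, aT T) * (∏ X ∈ 𝒳, aX X) * ∏ Y ∈ 𝒴, aY (𝒯.biUnion id) Y) := by
    intro 𝒯 h𝒯 𝒳 h𝒳 𝒴 h𝒴
    split_ifs with hcov
    · exact under2Weight_le_print U.2.1 U.2.2 (Finset.mem_powerset.1 h𝒯) (Finset.mem_powerset.1 h𝒳)
        (Finset.mem_powerset.1 h𝒴) hcov hC hlam hlam1 hβ hβn₀ hκ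
    · exact mul_nonneg hA0 (mul_nonneg (mul_nonneg (Finset.prod_nonneg fun T _ => haT0 T)
        (Finset.prod_nonneg fun X _ => haX0 X)) (Finset.prod_nonneg fun Y _ => haY0 _ Y))
  have h3 : ∀ 𝒯 ∈ P.powerset, ∀ 𝒳 ∈ P.powerset,
      ∑ 𝒴 ∈ (modPolymersIn U.1 (𝒯.biUnion id)).powerset,
        (if 𝒯.biUnion id ∪ 𝒳.biUnion id ∪ 𝒴.biUnion id = U.1 then under2Weight C lam β κ' n₀ 𝒯 𝒳 𝒴
          else 0) ≤ A * (∏ T ∈ 𝒯, aT T) * (∏ X ∈ 𝒳, aX X) * EY := by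
    intro 𝒯 h𝒯 𝒳 h𝒳
    calc _ ≤ ∑ 𝒴 ∈ (modPolymersIn U.1 (𝒯.biUnion id)).powerset,
          A * ((∏ T ∈ 𝒯, aT T) * (∏ X ∈ 𝒳, aX X) * ∏ Y ∈ 𝒴, aY (𝒯.biUnion id) Y) :=
          Finset.sum_le_sum fun 𝒴 h𝒴 => h2 𝒯 h𝒯 𝒳 h𝒳 𝒴 h𝒴
      _ = A * (∏ T ∈ 𝒯, aT T) * (∏ X ∈ 𝒳, aX X) *
          ∑ 𝒴 ∈ (modPolymersIn U.1 (𝒯.biUnion id)).powerset, ∏ Y ∈ 𝒴, aY (𝒯.biUnion id) Y := by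
          rw [Finset.mul_sum]
          refine Finset.sum_congr rfl fun 𝒴 _ => by ring
      _ ≤ A * (∏ T ∈ 𝒯, aT T) * (∏ X ∈ 𝒳, aX X) * EY :=
          mul_le_mul_of_nonneg_left (hY _) (mul_nonneg (mul_nonneg hA0
            (Finset.prod_nonneg fun T _ => haT0 T)) (Finset.prod_nonneg fun X _ => haX0 X))
  have h4 : ∀ 𝒯 ∈ P.powerset,
      ∑ 𝒳 ∈ P.powerset, ∑ 𝒴 ∈ (modPolymersIn U.1 (𝒯.biUnion id)).powerset,
        (if 𝒯.biUnion id ∪ 𝒳.biUnion id ∪ 𝒴.biUnion id = U.1 then under2Weight C lam β κ' n₀ 𝒯 𝒳 𝒴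
          else 0) ≤ A * (∏ T ∈ 𝒯, aT T) * EX * EY := by
    intro 𝒯 h𝒯
    calc _ ≤ ∑ 𝒳 ∈ P.powerset, A * (∏ T ∈ 𝒯, aT T) * (∏ X ∈ 𝒳, aX X) * EY :=
          Finset.sum_le_sum fun 𝒳 h𝒳 => h3 𝒯 h𝒯 𝒳 h𝒳
      _ = A * (∏ T ∈ 𝒯, aT T) * EY * ∑ 𝒳 ∈ P.powerset, ∏ X ∈ 𝒳, aX X := by
          rw [Finset.mul_sum]
          refine Finset.sum_congr rfl fun 𝒳 _ => by ring
      _ ≤ A * (∏ T ∈ 𝒯, aT T) * EY * EX :=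
          mul_le_mul_of_nonneg_left hX (mul_nonneg (mul_nonneg hA0
            (Finset.prod_nonneg fun T _ => haT0 T)) (exp_pos _).le)
      _ = _ := by ring
  have h5 : |K U| ≤ A * ET * EX * EY := by
    calc |K U| ≤ _ := hK U
      _ ≤ ∑ 𝒯 ∈ P.powerset, A * (∏ T ∈ 𝒯, aT T) * EX * EY := Finset.sum_le_sum fun 𝒯 h𝒯 => h4 𝒯 h𝒯
      _ = A * EX * EY * ∑ 𝒯 ∈ P.powerset, ∏ T ∈ 𝒯, aT T := by
          rw [Finset.mul_sum]
          refine Finset.sum_congr rfl fun 𝒯 _ => by ring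
      _ ≤ A * EX * EY * ET :=
          mul_le_mul_of_nonneg_left hT (mul_nonneg (mul_nonneg hA0 (exp_pos _).le) (exp_pos _).le)
      _ = _ := by ring
  have hfin : A * ET * EX * EY = lam ^ (β / 2) *
      exp (-((κ' - κ₀ - 1 + 1) * torusTreeLen U.1) +
        (E * (K₀ 32 6 + C * K₀ 32 6 + C * K₁)) * lam ^ (β / 2) * (U.1.card : ℝ)) := by
    rw [hA, hET, hEX, hEY, mul_assoc, mul_assoc, mul_assoc, ← Real.exp_add, ← Real.exp_add, ← Real.exp_add]
    congr 2
    ring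
  rw [← hfin]
  exact h5

/-- (stingray) ∧ (under2) ∧ (snow) ⇒ Corollary 1 with the PRINTED absorption (no smallness `λ^{β/2}e^{2(κ′−κ₀)} ≤ 1`; the
gluing constants inside the 𝒪(1) of (toot), `c = e^{2(κ′−κ₀)}(K₀ + C K₀ + C K₁)`), composing `tootBound_of_under2_print`
with `stability_of_toot`. [cite: Dimock2013BalabanIII, §3.6 (arXiv:1304.0705v1 TeX L2346–2505)] -/
theorem stability_of_under2_print {L m Mv N : ℕ} [NeZero L] [NeZero (L ^ (Mv - m))] {lam ε₀ μ₀ : ℝ}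
    {K : TDom 3 (L ^ (Mv - m)) → ℝ} {C β κ' κ₀ K₁ r₁ : ℝ} {n₀ : ℕ} (hm : m ≤ Mv)
    (hrep : ComponentRepresentation L Mv N (L ^ (Mv - m)) lam ε₀ μ₀ K)
    (hK : Under2Bound (L ^ (Mv - m)) K C lam β κ' n₀) (hmod : SummingMod (L ^ (Mv - m)) κ₀ K₁)
    (hκ₀ : kappa₀ 32 6 ≤ κ₀) (hκ : κ₀ ≤ κ') (hC : 0 ≤ C) (hK₁ : 0 ≤ K₁) (hlam : 0 < lam)
    (hlam1 : lam ≤ 1) (hβ : 0 ≤ β) (hβn₀ : β ≤ n₀)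
    (htoot : 32 * (exp (2 * (κ' - κ₀)) * (K₀ 32 6 + C * K₀ 32 6 + C * K₁)) * lam ^ (β / 2) ≤ 1)
    (hr₁ : kappa₀ 32 6 ≤ r₁) (hrate : r₁ + 2 * kappa₀ 32 6 + 2 ≤ κ' - κ₀ - 1)
    (hKP : exp (1 / 4) * lam ^ (β / 2) * exp (5 * r₁ + 1) * K₀ 32 6 * 32 ≤ 1)
    (hM : exp 1 * 32 * K₀ 32 6 ^ 2 * exp (1 / 4) * K₀ 32 6 ≤ ((L : ℝ) ^ m) ^ 3) :
    exp (-(lam ^ (β / 2) * (L : ℝ) ^ (3 * Mv))) ≤ relativePartitionFunction L Mv N 1 lam ε₀ μ₀ ∧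
      relativePartitionFunction L Mv N 1 lam ε₀ μ₀ ≤ exp (lam ^ (β / 2) * (L : ℝ) ^ (3 * Mv)) := by
  have hK₀ : 0 ≤ K₀ 32 6 := (K₀_pos 32 6).le
  exact stability_of_toot hm hrep (tootBound_of_under2_print hK hmod hκ₀ hκ hC hK₁ hlam hlam1 hβ hβn₀)
    (by positivity) hlam htoot hr₁ hrate hKP hM

end Resummation

end Literature.MathematicalPhysics.QuantumFieldTheory.Dimock2011to13.ThreeSorted

end
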